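import Literature.Analysis.FluidPDE.PassiveVectorTensorLipschitzTest
import HarnessLib

/-!
# The distorted weak class paired with time-Lipschitz solenoidal fields: the space–time pairing
# identity, the backward-adjoint (form-perturbation) duality identity, and the duality estimate

Analysis/FluidPDE proof-support file (everything proved; no definitions, no named facts) over the
`G`-DISTORTED weak class `Torus.IsWeakTensorPassiveVectorDistortedOn A T 𝔸 b G w₀ w`
(`PassiveVectorTensorDistorted.lean`: `∂ₜw + (b·∇)w + A (w·∇)b + Gᵀ∇π = 𝓛^G w`, `∇·(G w) = 0`, tested
against time-Lipschitz, space-smooth fields `Ψ` with `∇·(G Ψ) = 0` vanishing near `T`).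

* §1 Time-Lipschitz space-smooth FIELDS on `[0,T]` (the test class without the compact support in
  time: smooth slices, all iterated space derivatives jointly continuous, Lipschitz in `t` uniformly in
  `y`) times a smooth compactly supported profile `η` with `tsupport η ⊆ (−∞,T)` are admissible tests
  (`isLipschitzSpaceTimeTest_smul`); `viscAdjVar` is homogeneous in the test field and additive in the
  coefficient tensor (`C¹` coefficients); the algebraic identities `⟪b, (w·∇)ψ⟫ = ⟪w, (⟪b, ∂ⱼψ⟫)ⱼ⟫` and
  `⟪w, Gᵀ z⟫ = ⟪G w, z⟫`.
* §2 **The space–time pairing identity** (DiPerna–Lions 1989, §II.1 (13)–(14); Temam 1997, Ch. II §3: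
  the weak formulation tested with `η(t) ψ(t,y)` and the du Bois-Reymond lemma with datum): if `ψ` is
  such a field with `∇·(G ψ) = 0` and an a.e.-in-time derivative `ψ'` (`∀ᵐ t, ∀ y,
  HasDerivAt (ψ · y) (ψ' t y) t` — the regularity of frame conjugates of smooth tests along a carrier
  that is piecewise smooth in time), then for a.e. `t ∈ (0,T)`
  `∫⟪w(t), ψ(t)⟫ = ∫⟪w₀, ψ(0)⟫ + ∫_{(0,t]} ∫ (⟪w, ψ' + (b·∇)ψ + 𝓛^{G,*}_𝔸 ψ⟫ + A⟪b, (w·∇)ψ⟫)`.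
* §3 **The backward-adjoint duality identity** (Lions–Magenes duality for the adjoint pair; here in
  the form in which a PERTURBATION of the viscosity tensor appears as a source): if moreover `ψ` solves
  classically, for a.e. `t` and every `y`, the backward adjoint distorted problem with the SAME `G, b, A`
  but a tensor `𝔸₂` and a space-smooth pressure `q`,
  `ψ' + (b·∇)ψ + 𝓛^{G,*}_{𝔸₂} ψ + A (⟪b, ∂ⱼψ⟫)ⱼ = Gᵀ ∇q`,
  then for a.e. `t`: `∫⟪w(t), ψ(t)⟫ − ∫⟪w₀, ψ(0)⟫ = ∫_{(0,t]} ∫ ⟪w, 𝓛^{G,*}_{𝔸 − 𝔸₂} ψ⟫`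
  (the pressure is killed by `∇·(G w) = 0`, the stretching terms cancel pointwise); with `𝔸₂ = 𝔸` the
  pairing is constant (duality). Integrability of the space–time integrands is an explicit hypothesis
  (the class builds in no regularity of `G`).
* §4 **The source in gradient form** (Giaquinta, Ch. III §2; Evans §5.2.1): against a field `v` with an
  integrable weak gradient `Gv` (`Torus.HasWeakGradient`), one integration by parts gives
  `∫⟪v, 𝓛^{𝔹,*}Ψ⟫ = −∫ Σ 𝔹_{icle} (∂_cΨ)_i (∂_e v)_l` (`integral_inner_viscAdjVar_eq_neg_integral_sum`), whence,
  under a form bound `|Σ 𝔹_{icle} ξ_{ci} η_{el}| ≤ K|ξ||η|` (from an entrywise bound: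
  `Visc4.form_bound_of_entry_bound`, `K = (card d)² M`), the slice estimate
  `|∫⟪v, 𝓛^{𝔹,*}Ψ⟫| ≤ K √(∫ weakGradNormSq Gv) √(gradNormSq Ψ)`
  (`abs_integral_inner_viscAdjVar_le_of_hasWeakGradient`) and, by Cauchy–Schwarz in time, the space–time
  estimate `abs_setIntegral_integral_inner_viscAdjVar_le`.
* §5 **The duality ESTIMATE** (`IsWeakTensorPassiveVectorDistortedOn.ae_abs_integral_inner_sub_le`): in the
  setting of §3 with `G(t,·)` smooth, `(𝔸 − 𝔸₂)^G` form-bounded by `K`, and `L²H¹` information on `w`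
  (a.e. slice weak gradients `Gw t` with time-integrable dissipation), for a.e. `t ∈ (0,T)`
  `|∫⟪w(t), ψ(t)⟫ − ∫⟪w₀, ψ(0)⟫| ≤ K √(∫_{(0,t]}∫|∇w|²) √(∫_{(0,t]} ‖∇ψ‖²_{L²})` — form perturbation × the
  geometric mean of the two dissipations.
* §6 **Discharging the integrability hypotheses**: the D3 copies of the flat carrier-integrability API
  (`integrable_norm_carrier_mul_norm`, `integrable_inner_of_bounded`, `integrable_inner_convect`,
  `integrable_inner_carrier_convect`), joint measurability and boundedness of `∂ₜψ = timeDeriv ψ` for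
  time-Lipschitz jointly continuous `ψ` (`integrable_inner_timeDeriv`, via `measurable_deriv_with_param`),
  joint continuity of `𝓛^{𝔹(t),*}ψ(t)` and of the conjugated coefficients `𝔹^{G}` and their
  `y`-derivatives (`continuous_uncurry_viscAdjVar`, `…_conj_entry`), whence the three hypotheses of §2/§3
  with `ψ' = timeDeriv ψ`: `integrable_weakIntegrand_lipschitzField` (= `hint`),
  `integrable_inner_viscAdjVar_conj` (= `hintV`), `integrable_inner_distort_transpose_gradient` (= `hintQ`),
  for `G` with `C¹` slices and `G`, `∂_yG`, `∇q` jointly continuous.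

Consumer: the K1L one-level split of route `SolenoidalFractalHomogenisation` (cell `ad-ideate`,
`stmt-AnomalousDissipation-27980`, sub-stubs (X_G)/(E_G′)/(V_G) of `stub_windowDefectL`: "form
perturbation × the two dissipations", LIT-REQ «DistortedEnergy» DE2/DE3).

## Mathlib / tree search

Tree: the flat/forced twins `IsWeakTensorPassiveVectorForcedOn.setIntegral_test_smul_spaceTime` /
`ae_integral_inner_spaceTime_eq` (`PassiveVectorTensorForcedRestart`), the du Bois-Reymond lemma with datum
`FunctionSpaces.ae_eq_add_setIntegral_of_forall_test` (`DuBoisReymondAE`), the test class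
`Torus.IsLipschitzSpaceTimeTest` and `IsWeakTensorPassiveVectorDistortedOn` (`PassiveVectorTensorDistorted`),
`isDivFree_const_smul_field` / `convect_const_smul_field` (`PassiveVectorTensorSpaceTimePairing`),
`partialDeriv_const_mul` (junk-free), `iterPartialDeriv_const_smul`; torus weak gradients
`Torus.HasWeakGradient` / `weakGradNormSq` (`DissipationAnomaly`; produced from `L²H¹` data by
`Torus.exists_hasWeakGradient_of_memL2Sobolev`, `DuchonRobertLocalBalance`), Mathlib's
`eval_integral_piLp`, `integral_mul_le_Lp_mul_Lq_of_nonneg` (Hölder). No pairing identity for the distorted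
class existed (`rg "DistortedOn" Literature/Analysis/FluidPDE`: class, kinematics, `G ≡ 1` bridges only).

## References

* R. J. DiPerna, P.-L. Lions, Invent. Math. 98 (1989), §II.1 (12)–(14) (weak linear transport–diffusion,
  test classes, the integrated-in-time form). [`DiPernaLions1989`]
* R. Temam, *Infinite-Dimensional Dynamical Systems in Mechanics and Physics*, 2nd ed. (Springer 1997),
  Ch. II §3.1–3.2, (3.2)–(3.5), Thm. 3.1 (a.e. form of the weak formulation in time). [`Temam1997`]
* J.-L. Lions, E. Magenes, *Non-Homogeneous Boundary Value Problems and Applications* I (Springer 1972),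
  Ch. 3 §4.3–4.4 (adjoint / transposition identity for linear parabolic problems). [`LionsMagenes1972`]
* M. Giaquinta, *Multiple integrals in the calculus of variations and nonlinear elliptic systems*
  (Princeton 1983), Ch. III §2 (2.1)–(2.3) (divergence-form systems with variable coefficients, the
  energy form). [`Giaquinta1983MultipleIntegrals`]
* L. C. Evans, *Partial Differential Equations*, 2nd ed. (AMS 2010), §5.2.1 (weak derivatives). [`Evans2010`]
-/

noncomputable section

open MeasureTheory Set Filter Function TopologicalSpace
open scoped ENNReal NNReal InnerProductSpace ContDiff Topology

namespace Literature.Analysis.FluidPDE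

namespace Torus

variable {d : Type*} [Fintype d] [DecidableEq d]

/-! ## §1 Time-Lipschitz fields times smooth profiles; algebra of the test operators -/

section Fields

variable {T : ℝ} {ψ : ℝ → UnitAddTorus d → EuclideanSpace ℝ d} {η : ℝ → ℝ}

omit [DecidableEq d] in
/-- A smooth compactly supported profile with `tsupport η ⊆ (−∞, T)` vanishes on `[T', ∞)` for some
`T' < T`. [folklore] -/
private theorem exists_lt_forall_eq_zero_of_tsupport (hηc : HasCompactSupport η) (hηT : tsupport η ⊆ Iio T) :
    ∃ T' < T, ∀ t, T' ≤ t → η t = 0 := by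
  by_cases hne : (tsupport η).Nonempty
  · have hM : sSup (tsupport η) ∈ tsupport η := hηc.sSup_mem hne
    have hMT : sSup (tsupport η) < T := hηT hM
    refine ⟨(sSup (tsupport η) + T) / 2, by linarith, fun t ht => ?_⟩
    refine image_eq_zero_of_notMem_tsupport fun htm => ?_
    have : t ≤ sSup (tsupport η) := le_csSup hηc.bddAbove htm
    linarith
  · rw [not_nonempty_iff_eq_empty, tsupport_eq_empty_iff] at hne
    exact ⟨T - 1, by linarith, fun t _ => by simp [hne]⟩

omit [Fintype d] [DecidableEq d] in
/-- A continuous function on `ℝ × T^d` is bounded on `[0,T] × T^d`. [folklore] -/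
private theorem exists_bound_on_slab {F' : Type*} [NormedAddCommGroup F'] {f : ℝ → UnitAddTorus d → F'}
    (hf : Continuous (uncurry f)) (T : ℝ) : ∃ C : ℝ, 0 ≤ C ∧ ∀ t ∈ Icc 0 T, ∀ y, ‖f t y‖ ≤ C := by
  obtain ⟨C, hC⟩ := (isCompact_Icc.prod isCompact_univ).exists_bound_of_continuousOn
    (s := Icc (0 : ℝ) T ×ˢ (univ : Set (UnitAddTorus d))) hf.continuousOn
  exact ⟨max C 0, le_max_right _ _, fun t ht y => (hC (t, y) ⟨ht, mem_univ _⟩).trans (le_max_left _ _)⟩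

/-- **A time-Lipschitz space-smooth field times a smooth compactly supported profile with
`tsupport η ⊆ (−∞,T)` is a time-Lipschitz space-smooth TEST field on `[0,T)`** (class
`Torus.IsLipschitzSpaceTimeTest`). The field: smooth slices, all iterated space derivatives jointly
continuous, Lipschitz in `t` on `[0,T]` uniformly in `y`. [cite: DiPernaLions1989, §II.1 (12)–(14)] -/
theorem isLipschitzSpaceTimeTest_smul (hψs : ∀ t, FunctionSpaces.Torus.IsSmooth (ψ t))
    (hψc : ∀ l : List d, Continuous (uncurry fun t y => FunctionSpaces.Torus.iterPartialDeriv l (ψ t) y))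
    (hψL : ∃ L : ℝ, 0 ≤ L ∧ ∀ t ∈ Icc 0 T, ∀ s ∈ Icc 0 T, ∀ y, ‖ψ t y - ψ s y‖ ≤ L * |t - s|)
    (hη : ContDiff ℝ ∞ η) (hηc : HasCompactSupport η) (hηT : tsupport η ⊆ Iio T) :
    IsLipschitzSpaceTimeTest T (fun t y => η t • ψ t y) := by
  have hiter : ∀ l : List d, (uncurry fun t y => FunctionSpaces.Torus.iterPartialDeriv l (fun y => η t • ψ t y) y) =
      fun p : ℝ × UnitAddTorus d => η p.1 • FunctionSpaces.Torus.iterPartialDeriv l (ψ p.1) p.2 := by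
    intro l
    funext p
    simp only [uncurry]
    rw [FunctionSpaces.Torus.iterPartialDeriv_const_smul (hψs p.1) (η p.1) l]
  have hcont : ∀ l : List d, Continuous (uncurry fun t y =>
      FunctionSpaces.Torus.iterPartialDeriv l (fun y => η t • ψ t y) y) := fun l => by
    rw [hiter l]
    exact (hη.continuous.comp continuous_fst).smul (hψc l)
  refine ⟨fun t => (hψs t).smul (η t), ?_, fun j => ?_, fun i j => ?_, hcont, ?_,
    ?_⟩
  · simpa using hcont []
  · simpa using hcont [j]
  · simpa using hcont [i, j]
  · obtain ⟨L, hL0, hL⟩ := hψL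
    obtain ⟨M, hM0, hM⟩ := exists_bound_on_slab (by simpa using hψc []) T
    obtain ⟨Ca, hCa⟩ := (hη.continuous_deriv (by simp)).bounded_above_of_compact_support hηc.deriv
    obtain ⟨Cb, hCb⟩ := hη.continuous.bounded_above_of_compact_support hηc
    have hCa0 : 0 ≤ Ca := (norm_nonneg _).trans (hCa 0)
    have hCb0 : 0 ≤ Cb := (norm_nonneg _).trans (hCb 0)
    refine ⟨Ca * M + Cb * L, by positivity, fun t ht s hs y => ?_⟩
    have hηts : ‖η t - η s‖ ≤ Ca * ‖t - s‖ :=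
      Convex.norm_image_sub_le_of_norm_deriv_le (fun x _ => (hη.differentiable (by simp)).differentiableAt)
        (fun x _ => hCa x) convex_univ (mem_univ s) (mem_univ t)
    rw [Real.norm_eq_abs] at hηts
    calc ‖η t • ψ t y - η s • ψ s y‖ = ‖(η t - η s) • ψ t y + η s • (ψ t y - ψ s y)‖ := by
          rw [sub_smul, smul_sub]; abel_nf
      _ ≤ ‖η t - η s‖ * ‖ψ t y‖ + ‖η s‖ * ‖ψ t y - ψ s y‖ := by
          refine (norm_add_le _ _).trans ?_
          rw [norm_smul, norm_smul]
      _ ≤ Ca * |t - s| * M + Cb * (L * |t - s|) := by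
          refine add_le_add (mul_le_mul hηts (hM t ht y) (norm_nonneg _) (by positivity))
            (mul_le_mul (hCb s) (hL t ht s hs y) (norm_nonneg _) hCb0)
      _ = (Ca * M + Cb * L) * |t - s| := by ring
  · obtain ⟨T', hT', h0⟩ := exists_lt_forall_eq_zero_of_tsupport hηc hηT
    exact ⟨T', hT', fun t ht => funext fun y => by simp [h0 t ht]⟩

omit [Fintype d] in
/-- `∂ᵢ (c f) = c ∂ᵢ f` for real functions, with no differentiability hypothesis (Mathlib
`deriv_const_mul_field'`). [folklore] -/
private theorem partialDeriv_const_mul₅ (c : ℝ) (f : UnitAddTorus d → ℝ) (i : d) (x : UnitAddTorus d) :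
    FunctionSpaces.Torus.partialDeriv i (fun y => c * f y) x = c * FunctionSpaces.Torus.partialDeriv i f x := by
  simp only [FunctionSpaces.Torus.partialDeriv, FunctionSpaces.Torus.lineDeriv, deriv_const_mul_field']

/-- `viscAdjVar` is homogeneous in the (C¹) test field: `𝓛^{𝔹,*}(c ψ) = c 𝓛^{𝔹,*} ψ`
(no regularity of the coefficient field is needed). [cite: Giaquinta1983MultipleIntegrals, Ch. III §2 eq. (2.1)-(2.3)] -/
theorem viscAdjVar_const_smul (𝔹 : UnitAddTorus d → Visc4 d) {Ψ : UnitAddTorus d → EuclideanSpace ℝ d}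
    (hΨ : FunctionSpaces.Torus.IsContDiff 1 Ψ) (c : ℝ) (x : UnitAddTorus d) :
    viscAdjVar 𝔹 (fun y => c • Ψ y) x = c • viscAdjVar 𝔹 Ψ x := by
  ext l
  rw [viscAdjVar_apply, PiLp.smul_apply, viscAdjVar_apply, smul_eq_mul, Finset.mul_sum]
  refine Finset.sum_congr rfl fun i _ => ?_
  rw [Finset.mul_sum]
  refine Finset.sum_congr rfl fun c' _ => ?_
  rw [Finset.mul_sum]
  refine Finset.sum_congr rfl fun e _ => ?_
  have hderiv : ∀ y, FunctionSpaces.Torus.partialDeriv c' (fun y => c • Ψ y) y i =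
      c * FunctionSpaces.Torus.partialDeriv c' Ψ y i := by
    intro y
    rw [show (fun y => c • Ψ y) = c • Ψ from rfl, FunctionSpaces.Torus.partialDeriv_const_smul hΨ c c']
    simp
  have e : (fun y => 𝔹 y i c' l e * FunctionSpaces.Torus.partialDeriv c' (fun y => c • Ψ y) y i) =
      fun y => c * (𝔹 y i c' l e * FunctionSpaces.Torus.partialDeriv c' Ψ y i) := by
    funext y; rw [hderiv y]; ring
  rw [e, partialDeriv_const_mul₅]

/-- `viscAdjVar` is additive in the coefficient tensor when the coefficient fields are `C¹` and the
test field is `C²`: `𝓛^{𝔹₁+𝔹₂,*} ψ = 𝓛^{𝔹₁,*} ψ + 𝓛^{𝔹₂,*} ψ`. [cite: Giaquinta1983MultipleIntegrals, Ch. III §2 eq. (2.1)-(2.3)] -/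
theorem viscAdjVar_add_tensor {𝔹₁ 𝔹₂ : UnitAddTorus d → Visc4 d}
    (h₁ : ∀ i c l e, FunctionSpaces.Torus.IsContDiff 1 (fun y => 𝔹₁ y i c l e))
    (h₂ : ∀ i c l e, FunctionSpaces.Torus.IsContDiff 1 (fun y => 𝔹₂ y i c l e))
    {Ψ : UnitAddTorus d → EuclideanSpace ℝ d} (hΨ : FunctionSpaces.Torus.IsSmooth Ψ) (x : UnitAddTorus d) :
    viscAdjVar (fun y => 𝔹₁ y + 𝔹₂ y) Ψ x = viscAdjVar 𝔹₁ Ψ x + viscAdjVar 𝔹₂ Ψ x := by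
  ext l
  rw [PiLp.add_apply, viscAdjVar_apply, viscAdjVar_apply, viscAdjVar_apply, ← Finset.sum_add_distrib]
  refine Finset.sum_congr rfl fun i _ => ?_
  rw [← Finset.sum_add_distrib]
  refine Finset.sum_congr rfl fun c _ => ?_
  rw [← Finset.sum_add_distrib]
  refine Finset.sum_congr rfl fun e _ => ?_
  have hD : FunctionSpaces.Torus.IsContDiff 1 (fun y => FunctionSpaces.Torus.partialDeriv c Ψ y i) :=
    ((hΨ.partialDeriv c).apply i).isContDiff (by simp)
  have hf₁ : FunctionSpaces.Torus.IsContDiff 1 (fun y => 𝔹₁ y i c l e * FunctionSpaces.Torus.partialDeriv c Ψ y i) :=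
    (h₁ i c l e).mul hD
  have hf₂ : FunctionSpaces.Torus.IsContDiff 1 (fun y => 𝔹₂ y i c l e * FunctionSpaces.Torus.partialDeriv c Ψ y i) :=
    (h₂ i c l e).mul hD
  have e1 : (fun y => (𝔹₁ y + 𝔹₂ y) i c l e * FunctionSpaces.Torus.partialDeriv c Ψ y i) =
      fun y => 𝔹₁ y i c l e * FunctionSpaces.Torus.partialDeriv c Ψ y i +
        𝔹₂ y i c l e * FunctionSpaces.Torus.partialDeriv c Ψ y i := by
    funext y; simp only [Pi.add_apply]; ring
  rw [e1]
  exact congrFun (FunctionSpaces.Torus.partialDeriv_add hf₁ hf₂ e) x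

/-- The stretching term in adjoint form: `⟪b, (w·∇)ψ⟫ = ⟪w, (⟪b, ∂ⱼψ⟫)ⱼ⟫` for a `C¹` field `ψ`.
[cite: Temam1997, Ch. II §3.1–3.2, (3.2)–(3.5), Thm. 3.1] -/
theorem inner_convect_eq_inner_stretchAdj {b w ψ : UnitAddTorus d → EuclideanSpace ℝ d}
    (hψ : FunctionSpaces.Torus.IsContDiff 1 ψ) (x : UnitAddTorus d) :
    ⟪b x, FunctionSpaces.Torus.convect w ψ x⟫_ℝ =
      ⟪w x, WithLp.toLp 2 fun j => ⟪b x, FunctionSpaces.Torus.partialDeriv j ψ x⟫_ℝ⟫_ℝ := by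
  classical
  rw [FunctionSpaces.Torus.convect_eq_sum_smul_partialDeriv hψ, inner_sum]
  rw [PiLp.inner_apply]
  simp only [RCLike.inner_apply, conj_trivial, real_inner_smul_right]
  refine Finset.sum_congr rfl fun j _ => ?_
  ring

omit [DecidableEq d] in
/-- Transposition under the pairing: `⟪v, Gᵀ z⟫ = ⟪G v, z⟫` pointwise. [folklore] -/
private theorem inner_distort_transpose (G : UnitAddTorus d → Matrix d d ℝ) (v z : UnitAddTorus d → EuclideanSpace ℝ d)
    (y : UnitAddTorus d) :
    ⟪v y, distort (fun y => (G y).transpose) z y⟫_ℝ = ⟪distort G v y, z y⟫_ℝ := by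
  rw [PiLp.inner_apply, PiLp.inner_apply]
  simp only [distort_apply, Matrix.transpose_apply, RCLike.inner_apply, conj_trivial, Finset.mul_sum,
    Finset.sum_mul]
  rw [Finset.sum_comm]
  refine Finset.sum_congr rfl fun a _ => Finset.sum_congr rfl fun c _ => ?_
  ring

end Fields

/-! ## §2 The space–time pairing identity for the distorted class -/

section Pairing

namespace IsWeakTensorPassiveVectorDistortedOn

variable {A T : ℝ} {𝔸 𝔸₂ : Visc4 d} {b w : ℝ → UnitAddTorus d → EuclideanSpace ℝ d}
  {G : ℝ → UnitAddTorus d → Matrix d d ℝ} {w₀ : UnitAddTorus d → EuclideanSpace ℝ d}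
  {ψ ψ' : ℝ → UnitAddTorus d → EuclideanSpace ℝ d} {q : ℝ → UnitAddTorus d → ℝ}

omit [DecidableEq d] in
/-- Almost every point of `(0,T) × 𝕋^d` (restricted product measure) has time coordinate in `(0,T)`.
[folklore] -/
private theorem ae_fst_mem_Ioo₅ (T : ℝ) :
    ∀ᵐ p : ℝ × UnitAddTorus d ∂(((volume : Measure ℝ).restrict (Ioo 0 T)).prod volume),
      p.1 ∈ Ioo 0 T :=
  (Measure.quasiMeasurePreserving_fst (μ := (volume : Measure ℝ).restrict (Ioo 0 T))
    (ν := (volume : Measure (UnitAddTorus d)))).ae (ae_restrict_mem measurableSet_Ioo)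

/-- Integrability on `(0,T) × T^d` of `⟪w, Φ⟫` for a jointly continuous field `Φ` (distorted class).
[cite: DiPernaLions1989, §II.1 (12)–(14)] -/
theorem integrable_inner_of_continuous (h : IsWeakTensorPassiveVectorDistortedOn A T 𝔸 b G w₀ w)
    {Φ : ℝ → UnitAddTorus d → EuclideanSpace ℝ d} (hΦ : Continuous (uncurry Φ)) :
    Integrable (fun p : ℝ × UnitAddTorus d => ⟪w p.1 p.2, Φ p.1 p.2⟫_ℝ)
      (((volume : Measure ℝ).restrict (Ioo 0 T)).prod volume) := by
  obtain ⟨C₀, hC₀⟩ := exists_bound_of_continuous_uncurry hΦ 0 T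
  have hG := h.integrable_uncurry
  refine Integrable.mono' (g := fun p : ℝ × UnitAddTorus d => ‖uncurry w p‖ * C₀)
    (hG.norm.mul_const C₀) (hG.1.inner hΦ.aestronglyMeasurable) ?_
  filter_upwards [ae_fst_mem_Ioo₅ (d := d) T] with p hp
  exact (norm_inner_le_norm _ _).trans (mul_le_mul_of_nonneg_left (hC₀ p.1 (Ioo_subset_Icc_self hp) p.2) (norm_nonneg _))

/-- **The distorted weak formulation tested with `η(t) • ψ(t,y)`** for a time-Lipschitz space-smooth
field `ψ` on `[0,T]` with `∇·(G ψ) = 0` and an a.e.-in-time derivative `ψ'` (every `y`), and a smooth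
compactly supported profile `η` with `tsupport η ⊆ (−∞,T)`:
`∫_{(0,T)} (η' ∫⟪w, ψ⟫ + η ∫(⟪w, ψ' + (b·∇)ψ + 𝓛^{G,*}_𝔸 ψ⟫ + A⟪b, (w·∇)ψ⟫)) + η(0)∫⟪w₀, ψ(0)⟫ = 0`
(the space–time integrand is assumed integrable: the class carries no regularity of `G`).
[cite: DiPernaLions1989, §II.1 (13)–(14)] [cite: Temam1997, Ch. II §3.1–3.2, (3.2)–(3.5), Thm. 3.1] -/
theorem setIntegral_test_smul_lipschitzField (h : IsWeakTensorPassiveVectorDistortedOn A T 𝔸 b G w₀ w)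
    (hψs : ∀ t, FunctionSpaces.Torus.IsSmooth (ψ t))
    (hψc : ∀ l : List d, Continuous (uncurry fun t y => FunctionSpaces.Torus.iterPartialDeriv l (ψ t) y))
    (hψL : ∃ L : ℝ, 0 ≤ L ∧ ∀ t ∈ Icc 0 T, ∀ s ∈ Icc 0 T, ∀ y, ‖ψ t y - ψ s y‖ ≤ L * |t - s|)
    (hψdiv : ∀ t, FunctionSpaces.Torus.IsDivFree (distort (G t) (ψ t)))
    (hψ' : ∀ᵐ t ∂(volume.restrict (Ioo 0 T)), ∀ y, HasDerivAt (fun s => ψ s y) (ψ' t y) t)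
    (hint : Integrable (fun p : ℝ × UnitAddTorus d =>
      ⟪w p.1 p.2, ψ' p.1 p.2 + FunctionSpaces.Torus.convect (b p.1) (ψ p.1) p.2 +
          viscAdjVar (fun y => Visc4.conj (G p.1 y) 𝔸) (ψ p.1) p.2⟫_ℝ +
        A * ⟪b p.1 p.2, FunctionSpaces.Torus.convect (w p.1) (ψ p.1) p.2⟫_ℝ)
      (((volume : Measure ℝ).restrict (Ioo 0 T)).prod volume))
    {η : ℝ → ℝ} (hη : ContDiff ℝ ∞ η) (hηc : HasCompactSupport η) (hηT : tsupport η ⊆ Iio T) :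
    (∫ t in Ioo 0 T, ((deriv η t * ∫ x, ⟪w t x, ψ t x⟫_ℝ) +
      η t * ∫ x, (⟪w t x, ψ' t x + FunctionSpaces.Torus.convect (b t) (ψ t) x +
          viscAdjVar (fun y => Visc4.conj (G t y) 𝔸) (ψ t) x⟫_ℝ +
        A * ⟪b t x, FunctionSpaces.Torus.convect (w t) (ψ t) x⟫_ℝ))) +
      η 0 * ∫ x, ⟪w₀ x, ψ 0 x⟫_ℝ = 0 := by
  have hΨ := isLipschitzSpaceTimeTest_smul hψs hψc hψL hη hηc hηT
  have hΨdiv : ∀ t, FunctionSpaces.Torus.IsDivFree (distort (G t) ((fun t y => η t • ψ t y) t)) := fun t => by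
    rw [show ((fun t y => η t • ψ t y) t) = η t • ψ t from rfl, distort_smul]
    exact isDivFree_const_smul_field (hψdiv t) (η t)
  have key := h.weak_eq _ hΨ hΨdiv
  have hψ1 : ∀ t, FunctionSpaces.Torus.IsContDiff 1 (ψ t) := fun t => (hψs t).isContDiff (by simp)
  -- pointwise expansion of the integrand, for a.e. `t` and every `x`
  have hpt : ∀ᵐ t ∂(volume.restrict (Ioo 0 T)), ∀ x,
      ⟪w t x, FunctionSpaces.Torus.timeDeriv (fun t y => η t • ψ t y) t x +
          FunctionSpaces.Torus.convect (b t) ((fun t y => η t • ψ t y) t) x +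
          viscAdjVar (fun y => Visc4.conj (G t y) 𝔸) ((fun t y => η t • ψ t y) t) x⟫_ℝ +
        A * ⟪b t x, FunctionSpaces.Torus.convect (w t) ((fun t y => η t • ψ t y) t) x⟫_ℝ =
      deriv η t * ⟪w t x, ψ t x⟫_ℝ +
        η t * (⟪w t x, ψ' t x + FunctionSpaces.Torus.convect (b t) (ψ t) x +
            viscAdjVar (fun y => Visc4.conj (G t y) 𝔸) (ψ t) x⟫_ℝ +
          A * ⟪b t x, FunctionSpaces.Torus.convect (w t) (ψ t) x⟫_ℝ) := by
    filter_upwards [hψ'] with t ht x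
    have hderiv : FunctionSpaces.Torus.timeDeriv (fun t y => η t • ψ t y) t x = deriv η t • ψ t x + η t • ψ' t x := by
      have h1 := ((hη.differentiable (by simp)).differentiableAt.hasDerivAt (x := t)).fun_smul (ht x)
      simp only [FunctionSpaces.Torus.timeDeriv]
      rw [h1.deriv, add_comm]
    rw [hderiv, show (fun y => η t • ψ t y) = η t • ψ t from rfl,
      convect_const_smul_field (hψ1 t), convect_const_smul_field (hψ1 t),
      show η t • ψ t = (fun y => η t • ψ t y) from rfl, viscAdjVar_const_smul _ (hψ1 t)]
    simp only [inner_add_right, inner_smul_right]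
    ring
  -- slice integrability
  have hUi := h.integrable_inner_of_continuous (Φ := ψ) (by simpa using hψc [])
  have hU1 := hUi.prod_right_ae
  have hF1 := hint.prod_right_ae
  have hae : ∀ᵐ t ∂(volume.restrict (Ioo 0 T)),
      (∫ x, (⟪w t x, FunctionSpaces.Torus.timeDeriv (fun t y => η t • ψ t y) t x +
          FunctionSpaces.Torus.convect (b t) ((fun t y => η t • ψ t y) t) x +
          viscAdjVar (fun y => Visc4.conj (G t y) 𝔸) ((fun t y => η t • ψ t y) t) x⟫_ℝ +
        A * ⟪b t x, FunctionSpaces.Torus.convect (w t) ((fun t y => η t • ψ t y) t) x⟫_ℝ)) =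
      (deriv η t * ∫ x, ⟪w t x, ψ t x⟫_ℝ) +
        η t * ∫ x, (⟪w t x, ψ' t x + FunctionSpaces.Torus.convect (b t) (ψ t) x +
            viscAdjVar (fun y => Visc4.conj (G t y) 𝔸) (ψ t) x⟫_ℝ +
          A * ⟪b t x, FunctionSpaces.Torus.convect (w t) (ψ t) x⟫_ℝ) := by
    filter_upwards [hpt, hU1, hF1] with t ht hU hF
    rw [integral_congr_ae (Eventually.of_forall ht), integral_add (hU.const_mul _) (hF.const_mul _),
      integral_const_mul, integral_const_mul]
  have e0 : ∫ x, ⟪w₀ x, (fun t y => η t • ψ t y) 0 x⟫_ℝ = η 0 * ∫ x, ⟪w₀ x, ψ 0 x⟫_ℝ := by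
    rw [← integral_const_mul]
    exact integral_congr_ae (Eventually.of_forall fun x => by simp only [inner_smul_right])
  rw [integral_congr_ae hae, e0] at key
  exact key

/-- **The space–time pairing identity for the distorted class** (a.e. du Bois-Reymond form): for a
time-Lipschitz space-smooth field `ψ` on `[0,T]` with `∇·(G ψ) = 0` and an a.e.-in-time derivative
`ψ'` (every `y`), for a.e. `t ∈ (0,T)`
`∫⟪w(t), ψ(t)⟫ = ∫⟪w₀, ψ(0)⟫ + ∫_{(0,t]} ∫(⟪w, ψ' + (b·∇)ψ + 𝓛^{G,*}_𝔸 ψ⟫ + A⟪b, (w·∇)ψ⟫)`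
(space–time integrand assumed integrable). [cite: DiPernaLions1989, §II.1 (13)–(14)] [cite: Temam1997, Ch. II §3.1–3.2, (3.2)–(3.5), Thm. 3.1] -/
theorem ae_integral_inner_lipschitzField_eq (h : IsWeakTensorPassiveVectorDistortedOn A T 𝔸 b G w₀ w)
    (hψs : ∀ t, FunctionSpaces.Torus.IsSmooth (ψ t))
    (hψc : ∀ l : List d, Continuous (uncurry fun t y => FunctionSpaces.Torus.iterPartialDeriv l (ψ t) y))
    (hψL : ∃ L : ℝ, 0 ≤ L ∧ ∀ t ∈ Icc 0 T, ∀ s ∈ Icc 0 T, ∀ y, ‖ψ t y - ψ s y‖ ≤ L * |t - s|)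
    (hψdiv : ∀ t, FunctionSpaces.Torus.IsDivFree (distort (G t) (ψ t)))
    (hψ' : ∀ᵐ t ∂(volume.restrict (Ioo 0 T)), ∀ y, HasDerivAt (fun s => ψ s y) (ψ' t y) t)
    (hint : Integrable (fun p : ℝ × UnitAddTorus d =>
      ⟪w p.1 p.2, ψ' p.1 p.2 + FunctionSpaces.Torus.convect (b p.1) (ψ p.1) p.2 +
          viscAdjVar (fun y => Visc4.conj (G p.1 y) 𝔸) (ψ p.1) p.2⟫_ℝ +
        A * ⟪b p.1 p.2, FunctionSpaces.Torus.convect (w p.1) (ψ p.1) p.2⟫_ℝ)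
      (((volume : Measure ℝ).restrict (Ioo 0 T)).prod volume)) :
    ∀ᵐ t ∂(volume.restrict (Ioo 0 T)),
      ∫ x, ⟪w t x, ψ t x⟫_ℝ = (∫ x, ⟪w₀ x, ψ 0 x⟫_ℝ) +
        ∫ τ in Ioc 0 t, ∫ x, (⟪w τ x, ψ' τ x + FunctionSpaces.Torus.convect (b τ) (ψ τ) x +
            viscAdjVar (fun y => Visc4.conj (G τ y) 𝔸) (ψ τ) x⟫_ℝ +
          A * ⟪b τ x, FunctionSpaces.Torus.convect (w τ) (ψ τ) x⟫_ℝ) := by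
  have hU : IntegrableOn (fun t => ∫ x, ⟪w t x, ψ t x⟫_ℝ) (Ioo 0 T) volume :=
    (h.integrable_inner_of_continuous (Φ := ψ) (by simpa using hψc [])).integral_prod_left
  have hF : IntegrableOn (fun t => ∫ x, (⟪w t x, ψ' t x + FunctionSpaces.Torus.convect (b t) (ψ t) x +
        viscAdjVar (fun y => Visc4.conj (G t y) 𝔸) (ψ t) x⟫_ℝ +
      A * ⟪b t x, FunctionSpaces.Torus.convect (w t) (ψ t) x⟫_ℝ)) (Ioo 0 T) volume :=
    hint.integral_prod_left
  exact FunctionSpaces.ae_eq_add_setIntegral_of_forall_test hU hF fun η hη hηc hηT =>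
    h.setIntegral_test_smul_lipschitzField hψs hψc hψL hψdiv hψ' hint hη hηc hηT

/-! ## §3 The backward-adjoint duality identity (form perturbation as a source) -/

/-- The pressure of the adjoint problem is killed by the distorted constraint: for a.e. `t`,
`∫⟪w(t), Gᵀ∇q(t)⟫ = ∫⟪G w(t), ∇q(t)⟫ = 0`. [cite: Temam1997, Ch. II §3.1–3.2, (3.2)–(3.5), Thm. 3.1] -/
theorem ae_integral_inner_distort_transpose_gradient_eq_zero (h : IsWeakTensorPassiveVectorDistortedOn A T 𝔸 b G w₀ w)
    (hq : ∀ t, FunctionSpaces.Torus.IsSmooth (q t)) :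
    ∀ᵐ t ∂(volume.restrict (Ioo 0 T)),
      ∫ x, ⟪w t x, distort (fun y => (G t y).transpose) (FunctionSpaces.Torus.gradient (q t)) x⟫_ℝ = 0 := by
  filter_upwards [h.ae_isWeaklyDivFree_distort] with t ht
  rw [show (fun x => ⟪w t x, distort (fun y => (G t y).transpose) (FunctionSpaces.Torus.gradient (q t)) x⟫_ℝ) =
    fun x => ⟪distort (G t) (w t) x, FunctionSpaces.Torus.gradient (q t) x⟫_ℝ from
    funext fun x => inner_distort_transpose (G t) (w t) _ x]
  exact ht (q t) (hq t)

/-- **The backward-adjoint duality identity with a perturbed tensor.** Let `w` be a distorted weak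
solution (tensor `𝔸`, distortion `G`, carrier `b`, coupling `A`, datum `w₀`) and let `ψ` be a
time-Lipschitz space-smooth field on `[0,T]` with `∇·(G ψ) = 0` and a.e.-in-time derivative `ψ'`,
solving CLASSICALLY (a.e. `t`, every `y`) the backward adjoint distorted problem with the same
`G, b, A`, a tensor `𝔸₂` and a space-smooth pressure `q`:
`ψ' + (b·∇)ψ + 𝓛^{G,*}_{𝔸₂} ψ + A (⟪b, ∂ⱼψ⟫)ⱼ = Gᵀ∇q`. Then for a.e. `t ∈ (0,T)`,

  `∫⟪w(t), ψ(t)⟫ = ∫⟪w₀, ψ(0)⟫ + ∫_{(0,t]} ∫ ⟪w, 𝓛^{G,*}_{𝔸−𝔸₂} ψ⟫`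

(the stretching terms cancel pointwise, the pressure is killed by `∇·(G w) = 0`; the three space–time
integrands are assumed integrable and `G(t,·) ∈ C¹` so that the tensors subtract inside `𝓛^{G,*}`).
With `𝔸₂ = 𝔸` the pairing is a.e. constant (duality); in general the right side is the
form-perturbation source consumed by Cauchy–Schwarz against the two dissipations.
[cite: LionsMagenes1972, Ch. 3 §4.3–4.4] [cite: Temam1997, Ch. II §3.1–3.2, (3.2)–(3.5), Thm. 3.1] -/
theorem ae_integral_inner_adjoint_eq (h : IsWeakTensorPassiveVectorDistortedOn A T 𝔸 b G w₀ w)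
    (hψs : ∀ t, FunctionSpaces.Torus.IsSmooth (ψ t))
    (hψc : ∀ l : List d, Continuous (uncurry fun t y => FunctionSpaces.Torus.iterPartialDeriv l (ψ t) y))
    (hψL : ∃ L : ℝ, 0 ≤ L ∧ ∀ t ∈ Icc 0 T, ∀ s ∈ Icc 0 T, ∀ y, ‖ψ t y - ψ s y‖ ≤ L * |t - s|)
    (hψdiv : ∀ t, FunctionSpaces.Torus.IsDivFree (distort (G t) (ψ t)))
    (hψ' : ∀ᵐ t ∂(volume.restrict (Ioo 0 T)), ∀ y, HasDerivAt (fun s => ψ s y) (ψ' t y) t)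
    (hG : ∀ t i j, FunctionSpaces.Torus.IsContDiff 1 (fun y => G t y i j)) (hq : ∀ t, FunctionSpaces.Torus.IsSmooth (q t))
    (hadj : ∀ᵐ t ∂(volume.restrict (Ioo 0 T)), ∀ y,
      ψ' t y + FunctionSpaces.Torus.convect (b t) (ψ t) y + viscAdjVar (fun y => Visc4.conj (G t y) 𝔸₂) (ψ t) y +
          A • (WithLp.toLp 2 fun j => ⟪b t y, FunctionSpaces.Torus.partialDeriv j (ψ t) y⟫_ℝ) =
        distort (fun y => (G t y).transpose) (FunctionSpaces.Torus.gradient (q t)) y)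
    (hint : Integrable (fun p : ℝ × UnitAddTorus d =>
      ⟪w p.1 p.2, ψ' p.1 p.2 + FunctionSpaces.Torus.convect (b p.1) (ψ p.1) p.2 +
          viscAdjVar (fun y => Visc4.conj (G p.1 y) 𝔸) (ψ p.1) p.2⟫_ℝ +
        A * ⟪b p.1 p.2, FunctionSpaces.Torus.convect (w p.1) (ψ p.1) p.2⟫_ℝ)
      (((volume : Measure ℝ).restrict (Ioo 0 T)).prod volume))
    (hintV : Integrable (fun p : ℝ × UnitAddTorus d =>
      ⟪w p.1 p.2, viscAdjVar (fun y => Visc4.conj (G p.1 y) (𝔸 - 𝔸₂)) (ψ p.1) p.2⟫_ℝ)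
      (((volume : Measure ℝ).restrict (Ioo 0 T)).prod volume))
    (hintQ : Integrable (fun p : ℝ × UnitAddTorus d =>
      ⟪w p.1 p.2, distort (fun y => (G p.1 y).transpose) (FunctionSpaces.Torus.gradient (q p.1)) p.2⟫_ℝ)
      (((volume : Measure ℝ).restrict (Ioo 0 T)).prod volume)) :
    ∀ᵐ t ∂(volume.restrict (Ioo 0 T)),
      ∫ x, ⟪w t x, ψ t x⟫_ℝ = (∫ x, ⟪w₀ x, ψ 0 x⟫_ℝ) +
        ∫ τ in Ioc 0 t, ∫ x, ⟪w τ x, viscAdjVar (fun y => Visc4.conj (G τ y) (𝔸 - 𝔸₂)) (ψ τ) x⟫_ℝ := by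
  have h1 := h.ae_integral_inner_lipschitzField_eq hψs hψc hψL hψdiv hψ' hint
  -- the pointwise reduction of the integrand, a.e. `t`, every `y`
  have hψ1 : ∀ t, FunctionSpaces.Torus.IsContDiff 1 (ψ t) := fun t => (hψs t).isContDiff (by simp)
  have hconj : ∀ t y, Visc4.conj (G t y) 𝔸 = Visc4.conj (G t y) 𝔸₂ + Visc4.conj (G t y) (𝔸 - 𝔸₂) := by
    intro t y
    rw [← Visc4.conj_add, add_sub_cancel]
  have hC1 : ∀ t (𝔹 : Visc4 d) i c l e, FunctionSpaces.Torus.IsContDiff 1 (fun y => Visc4.conj (G t y) 𝔹 i c l e) := by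
    intro t 𝔹 i c l e
    simp only [Visc4.conj_apply]
    have hG' := hG t
    unfold FunctionSpaces.Torus.IsContDiff at hG' ⊢
    exact ContDiff.sum fun a _ => ContDiff.sum fun b' _ => ((hG' c a).mul contDiff_const).mul (hG' e b')
  have hpt : ∀ᵐ t ∂(volume.restrict (Ioo 0 T)), ∀ y,
      ⟪w t y, ψ' t y + FunctionSpaces.Torus.convect (b t) (ψ t) y + viscAdjVar (fun y => Visc4.conj (G t y) 𝔸) (ψ t) y⟫_ℝ +
          A * ⟪b t y, FunctionSpaces.Torus.convect (w t) (ψ t) y⟫_ℝ =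
        ⟪w t y, distort (fun y => (G t y).transpose) (FunctionSpaces.Torus.gradient (q t)) y⟫_ℝ +
          ⟪w t y, viscAdjVar (fun y => Visc4.conj (G t y) (𝔸 - 𝔸₂)) (ψ t) y⟫_ℝ := by
    filter_upwards [hadj] with t ht y
    have hsplit : viscAdjVar (fun y => Visc4.conj (G t y) 𝔸) (ψ t) y =
        viscAdjVar (fun y => Visc4.conj (G t y) 𝔸₂) (ψ t) y + viscAdjVar (fun y => Visc4.conj (G t y) (𝔸 - 𝔸₂)) (ψ t) y := by
      rw [show (fun y => Visc4.conj (G t y) 𝔸) = fun y => Visc4.conj (G t y) 𝔸₂ + Visc4.conj (G t y) (𝔸 - 𝔸₂) from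
        funext fun y => hconj t y]
      exact viscAdjVar_add_tensor (hC1 t 𝔸₂) (hC1 t (𝔸 - 𝔸₂)) (hψs t) y
    have hstretch := inner_convect_eq_inner_stretchAdj (b := b t) (w := w t) (hψ1 t) y
    have hq' := ht y
    -- `ψ' + (b·∇)ψ + 𝓛_{𝔸₂}ψ = Gᵀ∇q − A S`
    have e1 : ψ' t y + FunctionSpaces.Torus.convect (b t) (ψ t) y + viscAdjVar (fun y => Visc4.conj (G t y) 𝔸) (ψ t) y =
        (distort (fun y => (G t y).transpose) (FunctionSpaces.Torus.gradient (q t)) y -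
          A • (WithLp.toLp 2 fun j => ⟪b t y, FunctionSpaces.Torus.partialDeriv j (ψ t) y⟫_ℝ)) +
          viscAdjVar (fun y => Visc4.conj (G t y) (𝔸 - 𝔸₂)) (ψ t) y := by
      rw [hsplit, ← hq']
      abel
    rw [e1, inner_add_right, inner_sub_right, inner_smul_right, hstretch]
    ring
  -- slice integrability and the reduced space integral, a.e. `t`
  have hQ0 := h.ae_integral_inner_distort_transpose_gradient_eq_zero hq
  have hred : ∀ᵐ t ∂(volume.restrict (Ioo 0 T)),
      (∫ y, (⟪w t y, ψ' t y + FunctionSpaces.Torus.convect (b t) (ψ t) y +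
          viscAdjVar (fun y => Visc4.conj (G t y) 𝔸) (ψ t) y⟫_ℝ +
        A * ⟪b t y, FunctionSpaces.Torus.convect (w t) (ψ t) y⟫_ℝ)) =
      ∫ y, ⟪w t y, viscAdjVar (fun y => Visc4.conj (G t y) (𝔸 - 𝔸₂)) (ψ t) y⟫_ℝ := by
    filter_upwards [hpt, hQ0, hintV.prod_right_ae, hintQ.prod_right_ae] with t ht h0 hV hQi
    rw [integral_congr_ae (Eventually.of_forall ht), integral_add hQi hV, h0, zero_add]
  -- the time integrals agree on every `(0,t]`, `t ∈ (0,T)`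
  filter_upwards [h1, ae_restrict_mem measurableSet_Ioo] with t ht htT
  rw [ht]
  congr 1
  refine setIntegral_congr_ae measurableSet_Ioc ?_
  have hsub : ∀ᵐ τ ∂(volume : Measure ℝ), τ ∈ Ioo 0 T → τ ∈ Ioc 0 t →
      (∫ y, (⟪w τ y, ψ' τ y + FunctionSpaces.Torus.convect (b τ) (ψ τ) y +
          viscAdjVar (fun y => Visc4.conj (G τ y) 𝔸) (ψ τ) y⟫_ℝ +
        A * ⟪b τ y, FunctionSpaces.Torus.convect (w τ) (ψ τ) y⟫_ℝ)) =
      ∫ y, ⟪w τ y, viscAdjVar (fun y => Visc4.conj (G τ y) (𝔸 - 𝔸₂)) (ψ τ) y⟫_ℝ := by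
    have := (ae_restrict_iff' measurableSet_Ioo).1 hred
    filter_upwards [this] with τ hτ hτT _
    exact hτ hτT
  filter_upwards [hsub] with τ hτ hτt
  exact hτ ⟨hτt.1, lt_of_le_of_lt hτt.2 htT.2⟩ hτt

end IsWeakTensorPassiveVectorDistortedOn

end Pairing

/-! ## §4 The form-perturbation source in gradient form: weak gradients and Cauchy–Schwarz -/

section GradientForm

variable {𝔹 : UnitAddTorus d → Visc4 d} {Ψ v : UnitAddTorus d → EuclideanSpace ℝ d}
  {Gv : UnitAddTorus d → EuclideanSpace ℝ d →L[ℝ] EuclideanSpace ℝ d} {K : ℝ}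

/-- Coefficient times a component of a first derivative of a smooth field is smooth. [folklore] -/
private theorem isSmooth_coeff_mul_partialDeriv
    (h𝔹 : ∀ i c l e, FunctionSpaces.Torus.IsSmooth (fun y => 𝔹 y i c l e))
    (hΨ : FunctionSpaces.Torus.IsSmooth Ψ) (i c l e : d) :
    FunctionSpaces.Torus.IsSmooth (fun y => 𝔹 y i c l e * (FunctionSpaces.Torus.partialDeriv c Ψ y) i) :=
  (h𝔹 i c l e).smul' ((hΨ.partialDeriv c).apply i)

omit [DecidableEq d] in
/-- Exchange of a fourfold finite sum with the integral. [folklore] -/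
private theorem integral_sum₄ {f : d → d → d → d → UnitAddTorus d → ℝ}
    (hf : ∀ l i c e, Integrable (f l i c e) volume) :
    ∫ x, ∑ l, ∑ i, ∑ c, ∑ e, f l i c e x = ∑ l, ∑ i, ∑ c, ∑ e, ∫ x, f l i c e x := by
  have h3 : ∀ l i, Integrable (fun x => ∑ c, ∑ e, f l i c e x) volume := fun l i =>
    integrable_finsetSum _ fun c _ => integrable_finsetSum _ fun e _ => hf l i c e
  have h2 : ∀ l, Integrable (fun x => ∑ i, ∑ c, ∑ e, f l i c e x) volume := fun l =>
    integrable_finsetSum _ fun i _ => h3 l i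
  rw [integral_finsetSum _ fun l _ => h2 l]
  refine Finset.sum_congr rfl fun l _ => ?_
  rw [integral_finsetSum _ fun i _ => h3 l i]
  refine Finset.sum_congr rfl fun i _ => ?_
  rw [integral_finsetSum _ fun c _ => integrable_finsetSum _ fun e _ => hf l i c e]
  refine Finset.sum_congr rfl fun c _ => ?_
  exact integral_finsetSum _ fun e _ => hf l i c e

/-- **The distorted test operator against a field with a weak gradient (one integration by parts):**
for smooth coefficients `𝔹`, a smooth field `Ψ`, and an integrable `v` with an integrable weak gradient
`Gv` (`Torus.HasWeakGradient`: `x ↦ Gv x eₑ` is a weak `e`-th partial derivative of `v`),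
`∫ ⟪v, 𝓛^{𝔹,*} Ψ⟫ = − ∫ Σ_{l,i,c,e} 𝔹_{icle} (∂_c Ψ)_i (∂_e v)_l` — the bilinear (energy) form of the
divergence-form operator with the derivative moved onto `v` (Giaquinta, Ch. III §2 (2.1)–(2.3); Evans
§5.2.1 for the weak derivative). [cite: Giaquinta1983MultipleIntegrals, Ch. III §2 eq. (2.1)-(2.3)] -/
theorem integral_inner_viscAdjVar_eq_neg_integral_sum
    (h𝔹 : ∀ i c l e, FunctionSpaces.Torus.IsSmooth (fun y => 𝔹 y i c l e))
    (hΨ : FunctionSpaces.Torus.IsSmooth Ψ) (hv : Integrable v volume)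
    (hG : HasWeakGradient v Gv) (hGi : Integrable Gv volume) :
    ∫ x, ⟪v x, viscAdjVar 𝔹 Ψ x⟫_ℝ =
      -∫ x, ∑ l, ∑ i, ∑ c, ∑ e, 𝔹 x i c l e * (FunctionSpaces.Torus.partialDeriv c Ψ x) i *
        (Gv x (EuclideanSpace.single e 1)) l := by
  set φ : d → d → d → d → UnitAddTorus d → ℝ :=
    fun l i c e y => 𝔹 y i c l e * (FunctionSpaces.Torus.partialDeriv c Ψ y) i with hφ
  have hφs : ∀ l i c e, FunctionSpaces.Torus.IsSmooth (φ l i c e) := fun l i c e =>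
    isSmooth_coeff_mul_partialDeriv h𝔹 hΨ i c l e
  have hGe : ∀ e, Integrable (fun x => Gv x (EuclideanSpace.single e 1)) volume := by
    intro e
    have := (ContinuousLinearMap.apply ℝ (EuclideanSpace ℝ d) (EuclideanSpace.single e (1 : ℝ))).integrable_comp hGi
    simpa only [ContinuousLinearMap.apply_apply] using this
  have hvl : ∀ l, Integrable (fun x => v x l) volume := fun l => hv.eval_piLp l
  -- the pointwise expansion of the pairing
  have hlhs : ∀ x, ⟪v x, viscAdjVar 𝔹 Ψ x⟫_ℝ =
      ∑ l, ∑ i, ∑ c, ∑ e, FunctionSpaces.Torus.partialDeriv e (φ l i c e) x * v x l := by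
    intro x
    rw [PiLp.inner_apply]
    refine Finset.sum_congr rfl fun l _ => ?_
    simp only [RCLike.inner_apply, conj_trivial, viscAdjVar_apply, Finset.sum_mul, hφ]
  -- one integration by parts per index, read in the coordinate `l`
  have hterm : ∀ l i c e, ∫ x, FunctionSpaces.Torus.partialDeriv e (φ l i c e) x * v x l =
      -∫ x, φ l i c e x * (Gv x (EuclideanSpace.single e 1)) l := by
    intro l i c e
    have hw := hG e (φ l i c e) (hφs l i c e)
    have hL : ∀ l', Integrable (fun x => (FunctionSpaces.Torus.partialDeriv e (φ l i c e) x • v x) l') volume :=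
      fun l' => (((hφs l i c e).partialDeriv e).integrable_smul hv).eval_piLp l'
    have hR : ∀ l', Integrable (fun x => (φ l i c e x • Gv x (EuclideanSpace.single e 1)) l') volume :=
      fun l' => ((hφs l i c e).integrable_smul (hGe e)).eval_piLp l'
    have h1 := congrArg (fun z : EuclideanSpace ℝ d => z l) hw
    simp only at h1
    rw [eval_integral_piLp hL l, WithLp.ofLp_neg, Pi.neg_apply, eval_integral_piLp hR l] at h1
    simpa only [PiLp.smul_apply, smul_eq_mul] using h1
  have hint : ∀ l i c e, Integrable (fun x => FunctionSpaces.Torus.partialDeriv e (φ l i c e) x * v x l) volume :=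
    fun l i c e => ((hφs l i c e).partialDeriv e).integrable_smul (hvl l)
  have hint' : ∀ l i c e, Integrable (fun x => φ l i c e x * (Gv x (EuclideanSpace.single e 1)) l) volume :=
    fun l i c e => (hφs l i c e).integrable_smul ((hGe e).eval_piLp l)
  rw [show (fun x => ⟪v x, viscAdjVar 𝔹 Ψ x⟫_ℝ) =
      fun x => ∑ l, ∑ i, ∑ c, ∑ e, FunctionSpaces.Torus.partialDeriv e (φ l i c e) x * v x l from funext hlhs,
    integral_sum₄ hint]
  rw [show (fun x => ∑ l, ∑ i, ∑ c, ∑ e, 𝔹 x i c l e * (FunctionSpaces.Torus.partialDeriv c Ψ x) i *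
        (Gv x (EuclideanSpace.single e 1)) l) =
      fun x => ∑ l, ∑ i, ∑ c, ∑ e, φ l i c e x * (Gv x (EuclideanSpace.single e 1)) l from
    funext fun x => by simp only [hφ], integral_sum₄ hint']
  simp only [hterm, Finset.sum_neg_distrib]

/-- **Cauchy–Schwarz for `√A √B`** on a measure space: `∫ √A √B ≤ √(∫A) √(∫B)` for integrable
nonnegative `A, B` (Hölder with `p = q = 2`). [folklore] -/
private theorem integral_sqrt_mul_sqrt_le {α : Type*} [MeasurableSpace α] {μ : Measure α} {A B : α → ℝ}
    (hA : Integrable A μ) (hB : Integrable B μ) (hA0 : 0 ≤ᵐ[μ] A) (hB0 : 0 ≤ᵐ[μ] B) :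
    ∫ x, Real.sqrt (A x) * Real.sqrt (B x) ∂μ ≤ Real.sqrt (∫ x, A x ∂μ) * Real.sqrt (∫ x, B x ∂μ) := by
  have h2 : ENNReal.ofReal (2 : ℝ) = 2 := by simp
  have hmem : ∀ {C : α → ℝ}, Integrable C μ → 0 ≤ᵐ[μ] C → MemLp (fun x => Real.sqrt (C x)) 2 μ := by
    intro C hC hC0
    rw [memLp_two_iff_integrable_sq (Real.continuous_sqrt.comp_aestronglyMeasurable hC.1)]
    exact hC.congr (hC0.mono fun x hx => (Real.sq_sqrt hx).symm)
  have hH := integral_mul_le_Lp_mul_Lq_of_nonneg (μ := μ) Real.HolderConjugate.two_two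
    (f := fun x => Real.sqrt (A x)) (g := fun x => Real.sqrt (B x))
    (ae_of_all _ fun x => Real.sqrt_nonneg _) (ae_of_all _ fun x => Real.sqrt_nonneg _)
    (by rw [h2]; exact hmem hA hA0) (by rw [h2]; exact hmem hB hB0)
  simp only [Real.rpow_two] at hH
  have eA : ∫ x, Real.sqrt (A x) ^ 2 ∂μ = ∫ x, A x ∂μ := integral_congr_ae (hA0.mono fun x hx => Real.sq_sqrt hx)
  have eB : ∫ x, Real.sqrt (B x) ^ 2 ∂μ = ∫ x, B x ∂μ := integral_congr_ae (hB0.mono fun x hx => Real.sq_sqrt hx)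
  rw [eA, eB] at hH
  rwa [Real.sqrt_eq_rpow, Real.sqrt_eq_rpow]

/-- **`|∫ F| ≤ K √(∫A) √(∫B)` from the pointwise `|F| ≤ K √A √B`** (Cauchy–Schwarz). [folklore] -/
private theorem abs_integral_le_of_abs_le_sqrt_mul_sqrt {α : Type*} [MeasurableSpace α] {μ : Measure α}
    {F A B : α → ℝ} {K : ℝ} (hK0 : 0 ≤ K) (hF : ∀ᵐ x ∂μ, |F x| ≤ K * Real.sqrt (A x) * Real.sqrt (B x))
    (hA : Integrable A μ) (hB : Integrable B μ) (hA0 : 0 ≤ᵐ[μ] A) (hB0 : 0 ≤ᵐ[μ] B) :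
    |∫ x, F x ∂μ| ≤ K * Real.sqrt (∫ x, A x ∂μ) * Real.sqrt (∫ x, B x ∂μ) := by
  -- integrability of the majorant: `2 √A √B ≤ A + B`
  have hmeas : AEStronglyMeasurable (fun x => Real.sqrt (A x) * Real.sqrt (B x)) μ :=
    (Real.continuous_sqrt.comp_aestronglyMeasurable hA.1).mul (Real.continuous_sqrt.comp_aestronglyMeasurable hB.1)
  have hprod : Integrable (fun x => Real.sqrt (A x) * Real.sqrt (B x)) μ := by
    refine Integrable.mono' (hA.add hB) hmeas ?_
    filter_upwards [hA0, hB0] with x hxA hxB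
    simp only [Pi.zero_apply] at hxA hxB
    rw [Real.norm_eq_abs, abs_of_nonneg (mul_nonneg (Real.sqrt_nonneg _) (Real.sqrt_nonneg _)), Pi.add_apply]
    nlinarith [sq_nonneg (Real.sqrt (A x) - Real.sqrt (B x)), Real.sq_sqrt hxA, Real.sq_sqrt hxB,
      Real.sqrt_nonneg (A x), Real.sqrt_nonneg (B x)]
  calc |∫ x, F x ∂μ| ≤ ∫ x, |F x| ∂μ := abs_integral_le_integral_abs
    _ ≤ ∫ x, K * (Real.sqrt (A x) * Real.sqrt (B x)) ∂μ := by
        refine integral_mono_of_nonneg (Eventually.of_forall fun x => abs_nonneg _) (hprod.const_mul K) ?_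
        filter_upwards [hF] with x hx
        simpa only [mul_assoc] using hx
    _ = K * ∫ x, Real.sqrt (A x) * Real.sqrt (B x) ∂μ := integral_const_mul _ _
    _ ≤ K * (Real.sqrt (∫ x, A x ∂μ) * Real.sqrt (∫ x, B x ∂μ)) :=
        mul_le_mul_of_nonneg_left (integral_sqrt_mul_sqrt_le hA hB hA0 hB0) hK0
    _ = K * Real.sqrt (∫ x, A x ∂μ) * Real.sqrt (∫ x, B x ∂μ) := (mul_assoc _ _ _).symm

/-- **The source bounded by the two dissipations (slice):** if the coefficient field satisfies the
form bound `|Σ 𝔹_{icle}(y) ξ_{ci} η_{el}| ≤ K |ξ| |η|` (Frobenius norms), then for smooth `Ψ` and an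
integrable `v` with an integrable weak gradient `Gv` of integrable squared Frobenius norm,
`|∫ ⟪v, 𝓛^{𝔹,*} Ψ⟫| ≤ K ‖∇v‖_{L²} ‖∇Ψ‖_{L²}`, i.e.
`≤ K √(∫ weakGradNormSq Gv) √(gradNormSq Ψ)` (integration by parts and Cauchy–Schwarz, pointwise and in
`L²`; Giaquinta, Ch. III §2: the energy-form estimate of a divergence-form operator).
[cite: Giaquinta1983MultipleIntegrals, Ch. III §2 eq. (2.1)-(2.3)] -/
theorem abs_integral_inner_viscAdjVar_le_of_hasWeakGradient
    (h𝔹 : ∀ i c l e, FunctionSpaces.Torus.IsSmooth (fun y => 𝔹 y i c l e)) (hK0 : 0 ≤ K)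
    (hK : ∀ y (ξ η : d → d → ℝ), |∑ l, ∑ i, ∑ c, ∑ e, 𝔹 y i c l e * ξ c i * η e l| ≤
      K * Real.sqrt (∑ c, ∑ i, ξ c i ^ 2) * Real.sqrt (∑ e, ∑ l, η e l ^ 2))
    (hΨ : FunctionSpaces.Torus.IsSmooth Ψ) (hv : Integrable v volume)
    (hG : HasWeakGradient v Gv) (hGi : Integrable Gv volume)
    (hG2 : Integrable (weakGradNormSq Gv) volume) :
    |∫ x, ⟪v x, viscAdjVar 𝔹 Ψ x⟫_ℝ| ≤
      K * Real.sqrt (∫ x, weakGradNormSq Gv x) * Real.sqrt (FunctionSpaces.Torus.gradNormSq Ψ) := by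
  rw [integral_inner_viscAdjVar_eq_neg_integral_sum h𝔹 hΨ hv hG hGi, abs_neg]
  set a : UnitAddTorus d → ℝ := fun x => ∑ c, ‖FunctionSpaces.Torus.partialDeriv c Ψ x‖ ^ 2 with ha
  have ha_eq : ∀ x, ∑ c, ∑ i, ((FunctionSpaces.Torus.partialDeriv c Ψ x) i) ^ 2 = a x := by
    intro x
    refine Finset.sum_congr rfl fun c _ => ?_
    rw [EuclideanSpace.norm_sq_eq]
    exact Finset.sum_congr rfl fun i _ => by rw [Real.norm_eq_abs, sq_abs]
  have hb_eq : ∀ x, ∑ e, ∑ l, ((Gv x (EuclideanSpace.single e 1)) l) ^ 2 = weakGradNormSq Gv x := by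
    intro x
    rw [weakGradNormSq_eq_sum]
    refine Finset.sum_congr rfl fun e _ => ?_
    rw [EuclideanSpace.norm_sq_eq]
    exact Finset.sum_congr rfl fun l _ => by rw [Real.norm_eq_abs, sq_abs]
  have hpt : ∀ x, |∑ l, ∑ i, ∑ c, ∑ e, 𝔹 x i c l e * (FunctionSpaces.Torus.partialDeriv c Ψ x) i *
      (Gv x (EuclideanSpace.single e 1)) l| ≤ K * Real.sqrt (a x) * Real.sqrt (weakGradNormSq Gv x) := by
    intro x
    have := hK x (fun c i => (FunctionSpaces.Torus.partialDeriv c Ψ x) i)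
      (fun e l => (Gv x (EuclideanSpace.single e 1)) l)
    rwa [ha_eq, hb_eq] at this
  have ha_int : Integrable a volume :=
    (continuous_finsetSum _ fun c _ => ((hΨ.partialDeriv c).continuous.norm).pow 2).integrable_unitAddTorus
  have := abs_integral_le_of_abs_le_sqrt_mul_sqrt (μ := volume) hK0 (Eventually.of_forall hpt) ha_int hG2
    (Eventually.of_forall fun x => Finset.sum_nonneg fun c _ => sq_nonneg _)
    (Eventually.of_forall fun x => weakGradNormSq_nonneg _ _)
  simpa only [ha, FunctionSpaces.Torus.gradNormSq, mul_comm, mul_left_comm, mul_assoc] using this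

omit [DecidableEq d] in
/-- A finite-sum Cauchy–Schwarz: `Σ_{c,i} |ξ_{ci}| ≤ (card d) √(Σ ξ²)`. [folklore] -/
private theorem sum_sum_abs_le_card_mul_sqrt (ξ : d → d → ℝ) :
    ∑ c, ∑ i, |ξ c i| ≤ (Fintype.card d : ℝ) * Real.sqrt (∑ c, ∑ i, ξ c i ^ 2) := by
  have h1 : (∑ c, ∑ i, |ξ c i|) ^ 2 ≤ ((Fintype.card d : ℝ) ^ 2) * ∑ c, ∑ i, ξ c i ^ 2 := by
    rw [← Fintype.sum_prod_type', ← Fintype.sum_prod_type']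
    have hcs := Finset.sum_mul_sq_le_sq_mul_sq (Finset.univ : Finset (d × d)) (fun _ => (1 : ℝ)) (fun p => |ξ p.1 p.2|)
    simp only [one_mul, one_pow, Finset.sum_const, Finset.card_univ, Fintype.card_prod, nsmul_eq_mul,
      mul_one, Nat.cast_mul, sq_abs] at hcs
    simpa only [sq, mul_assoc] using hcs
  have h0 : 0 ≤ ∑ c, ∑ i, |ξ c i| := Finset.sum_nonneg fun c _ => Finset.sum_nonneg fun i _ => abs_nonneg _
  have hs0 : 0 ≤ ∑ c, ∑ i, ξ c i ^ 2 := Finset.sum_nonneg fun c _ => Finset.sum_nonneg fun i _ => sq_nonneg _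
  have hR : 0 ≤ (Fintype.card d : ℝ) * Real.sqrt (∑ c, ∑ i, ξ c i ^ 2) := by positivity
  have h2 : ((Fintype.card d : ℝ) * Real.sqrt (∑ c, ∑ i, ξ c i ^ 2)) ^ 2 =
      ((Fintype.card d : ℝ) ^ 2) * ∑ c, ∑ i, ξ c i ^ 2 := by
    rw [mul_pow, Real.sq_sqrt hs0]
  rw [← h2] at h1
  exact (pow_le_pow_iff_left₀ h0 hR two_ne_zero).1 h1

omit [DecidableEq d] in
/-- Reordering a fourfold product sum into a product of two double sums. [folklore] -/
private theorem sum₄_mul_eq_sum_mul_sum (a b : d → d → ℝ) :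
    ∑ l, ∑ i, ∑ c, ∑ e, a c i * b e l = (∑ c, ∑ i, a c i) * (∑ e, ∑ l, b e l) := by
  calc ∑ l, ∑ i, ∑ c, ∑ e, a c i * b e l
      = ∑ l, ∑ i, (∑ c, a c i) * (∑ e, b e l) := by simp_rw [Finset.sum_mul_sum]
    _ = ∑ i, ∑ l, (∑ c, a c i) * (∑ e, b e l) := Finset.sum_comm
    _ = ∑ i, (∑ c, a c i) * ∑ l, ∑ e, b e l := by simp_rw [Finset.mul_sum]
    _ = (∑ i, ∑ c, a c i) * ∑ l, ∑ e, b e l := by rw [Finset.sum_mul]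
    _ = (∑ c, ∑ i, a c i) * (∑ e, ∑ l, b e l) := by
        rw [Finset.sum_comm, Finset.sum_comm (f := fun l e => b e l)]

omit [DecidableEq d] in
/-- **Entrywise bound ⇒ form bound**: if `|𝔹_{icle}(y)| ≤ M` for all indices then
`|Σ 𝔹_{icle} ξ_{ci} η_{el}| ≤ (card d)² M |ξ| |η|` — the hypothesis `hK` of
`abs_integral_inner_viscAdjVar_le_of_hasWeakGradient` with `K = (card d)² M` (the boundedness of the
coefficient form of a divergence-form operator with bounded coefficients, Giaquinta Ch. III §2 (2.2)).
[cite: Giaquinta1983MultipleIntegrals, Ch. III §2 eq. (2.1)-(2.3)] -/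
theorem Visc4.form_bound_of_entry_bound {𝔹 : UnitAddTorus d → Visc4 d} {M : ℝ} (hM : 0 ≤ M)
    (h : ∀ y i c l e, |𝔹 y i c l e| ≤ M) (y : UnitAddTorus d) (ξ η : d → d → ℝ) :
    |∑ l, ∑ i, ∑ c, ∑ e, 𝔹 y i c l e * ξ c i * η e l| ≤
      ((Fintype.card d : ℝ) ^ 2 * M) * Real.sqrt (∑ c, ∑ i, ξ c i ^ 2) * Real.sqrt (∑ e, ∑ l, η e l ^ 2) := by
  have hX := sum_sum_abs_le_card_mul_sqrt ξ
  have hY := sum_sum_abs_le_card_mul_sqrt η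
  have hX0 : 0 ≤ ∑ c, ∑ i, |ξ c i| := Finset.sum_nonneg fun _ _ => Finset.sum_nonneg fun _ _ => abs_nonneg _
  have hY0 : 0 ≤ ∑ e, ∑ l, |η e l| := Finset.sum_nonneg fun _ _ => Finset.sum_nonneg fun _ _ => abs_nonneg _
  calc |∑ l, ∑ i, ∑ c, ∑ e, 𝔹 y i c l e * ξ c i * η e l|
      ≤ ∑ l, ∑ i, ∑ c, ∑ e, |𝔹 y i c l e * ξ c i * η e l| := by
        refine (Finset.abs_sum_le_sum_abs _ _).trans (Finset.sum_le_sum fun l _ => ?_)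
        refine (Finset.abs_sum_le_sum_abs _ _).trans (Finset.sum_le_sum fun i _ => ?_)
        exact (Finset.abs_sum_le_sum_abs _ _).trans (Finset.sum_le_sum fun c _ => Finset.abs_sum_le_sum_abs _ _)
    _ ≤ ∑ l, ∑ i, ∑ c, ∑ e, M * (|ξ c i| * |η e l|) := by
        refine Finset.sum_le_sum fun l _ => Finset.sum_le_sum fun i _ => Finset.sum_le_sum fun c _ =>
          Finset.sum_le_sum fun e _ => ?_
        rw [abs_mul, abs_mul, mul_assoc]
        exact mul_le_mul_of_nonneg_right (h y i c l e) (mul_nonneg (abs_nonneg _) (abs_nonneg _))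
    _ = M * ((∑ c, ∑ i, |ξ c i|) * (∑ e, ∑ l, |η e l|)) := by
        rw [← sum₄_mul_eq_sum_mul_sum]
        simp only [Finset.mul_sum]
    _ ≤ M * (((Fintype.card d : ℝ) * Real.sqrt (∑ c, ∑ i, ξ c i ^ 2)) *
          ((Fintype.card d : ℝ) * Real.sqrt (∑ e, ∑ l, η e l ^ 2))) :=
        mul_le_mul_of_nonneg_left (mul_le_mul hX hY hY0 (by positivity)) hM
    _ = ((Fintype.card d : ℝ) ^ 2 * M) * Real.sqrt (∑ c, ∑ i, ξ c i ^ 2) * Real.sqrt (∑ e, ∑ l, η e l ^ 2) := by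
        ring

/-- **The source bounded by the two dissipations (space–time):** a.e.-in-`τ` slice data on a
measurable set `S` of times — smooth coefficients `𝔹 τ` with a uniform form bound `K`, smooth `ψ τ`,
integrable `v τ` with integrable weak gradients `Gv τ` of integrable squared norm — and time-integrable
dissipations give
`|∫_S ∫⟪v, 𝓛^{𝔹,*} ψ⟫| ≤ K √(∫_S ∫ weakGradNormSq (Gv τ)) √(∫_S gradNormSq (ψ τ))`
(the slice bound and Cauchy–Schwarz in time: form perturbation × the geometric mean of the two
dissipations; Giaquinta, Ch. III §2). [cite: Giaquinta1983MultipleIntegrals, Ch. III §2 eq. (2.1)-(2.3)] -/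
theorem abs_setIntegral_integral_inner_viscAdjVar_le
    {𝔹 : ℝ → UnitAddTorus d → Visc4 d} {ψ v : ℝ → UnitAddTorus d → EuclideanSpace ℝ d}
    {Gv : ℝ → UnitAddTorus d → EuclideanSpace ℝ d →L[ℝ] EuclideanSpace ℝ d} {K : ℝ} {S : Set ℝ}
    (hS : MeasurableSet S)
    (h𝔹 : ∀ τ i c l e, FunctionSpaces.Torus.IsSmooth (fun y => 𝔹 τ y i c l e)) (hK0 : 0 ≤ K)
    (hK : ∀ τ y (ξ η : d → d → ℝ), |∑ l, ∑ i, ∑ c, ∑ e, 𝔹 τ y i c l e * ξ c i * η e l| ≤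
      K * Real.sqrt (∑ c, ∑ i, ξ c i ^ 2) * Real.sqrt (∑ e, ∑ l, η e l ^ 2))
    (hψ : ∀ τ, FunctionSpaces.Torus.IsSmooth (ψ τ))
    (hv : ∀ᵐ τ ∂(volume.restrict S), Integrable (v τ) volume)
    (hG : ∀ᵐ τ ∂(volume.restrict S),
      HasWeakGradient (v τ) (Gv τ) ∧ Integrable (Gv τ) volume ∧ Integrable (weakGradNormSq (Gv τ)) volume)
    (hA : IntegrableOn (fun τ => ∫ x, weakGradNormSq (Gv τ) x) S volume)
    (hB : IntegrableOn (fun τ => FunctionSpaces.Torus.gradNormSq (ψ τ)) S volume) :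
    |∫ τ in S, ∫ x, ⟪v τ x, viscAdjVar (𝔹 τ) (ψ τ) x⟫_ℝ| ≤
      K * Real.sqrt (∫ τ in S, ∫ x, weakGradNormSq (Gv τ) x) *
        Real.sqrt (∫ τ in S, FunctionSpaces.Torus.gradNormSq (ψ τ)) := by
  have _ := hS
  refine abs_integral_le_of_abs_le_sqrt_mul_sqrt (μ := volume.restrict S) hK0 ?_ hA hB
    (Eventually.of_forall fun τ => integral_nonneg fun x => weakGradNormSq_nonneg _ _)
    (Eventually.of_forall fun τ => FunctionSpaces.Torus.gradNormSq_nonneg _)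
  filter_upwards [hv, hG] with τ hvτ hGτ
  exact abs_integral_inner_viscAdjVar_le_of_hasWeakGradient (h𝔹 τ) hK0 (hK τ) (hψ τ) hvτ hGτ.1 hGτ.2.1 hGτ.2.2

end GradientForm

/-! ## §5 The duality estimate: pairing defect ≤ form perturbation × the two dissipations -/

section DualityEstimate

namespace IsWeakTensorPassiveVectorDistortedOn

variable {A T : ℝ} {𝔸 𝔸₂ : Visc4 d} {b w : ℝ → UnitAddTorus d → EuclideanSpace ℝ d}
  {G : ℝ → UnitAddTorus d → Matrix d d ℝ} {w₀ : UnitAddTorus d → EuclideanSpace ℝ d}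
  {ψ ψ' : ℝ → UnitAddTorus d → EuclideanSpace ℝ d} {q : ℝ → UnitAddTorus d → ℝ}
  {Gw : ℝ → UnitAddTorus d → EuclideanSpace ℝ d →L[ℝ] EuclideanSpace ℝ d} {K : ℝ}

omit [DecidableEq d] in
/-- Entries of a conjugated tensor `𝔹^{G(y)}` are smooth in `y` when the entries of `G` are. [folklore] -/
private theorem isSmooth_conj_entry {Gs : UnitAddTorus d → Matrix d d ℝ}
    (hG : ∀ i j, FunctionSpaces.Torus.IsSmooth (fun y => Gs y i j)) (𝔹 : Visc4 d) (i c l e : d) :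
    FunctionSpaces.Torus.IsSmooth (fun y => Visc4.conj (Gs y) 𝔹 i c l e) := by
  simp only [Visc4.conj_apply]
  unfold FunctionSpaces.Torus.IsSmooth at hG ⊢
  exact ContDiff.sum fun a _ => ContDiff.sum fun b' _ => ((hG c a).mul contDiff_const).mul (hG e b')

/-- **The backward-adjoint duality ESTIMATE.** In the setting of `ae_integral_inner_adjoint_eq`
(distorted weak solution `w` with tensor `𝔸`; `ψ` a time-Lipschitz classical solution of the backward
adjoint distorted problem with tensor `𝔸₂`, the same `G, b, A`, pressure `q`), assume moreover that
`G(t,·)` has smooth entries, that the perturbation `(𝔸 − 𝔸₂)^{G}` obeys the form bound `K`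
uniformly, and that `w` has, for a.e. `t ∈ (0,T)`, an integrable weak gradient `Gw t` with
time-integrable dissipation `∫ weakGradNormSq (Gw t)` (the `L²H¹` information), `t ↦ gradNormSq (ψ t)`
integrable on `(0,T)`. Then for a.e. `t ∈ (0,T)`:

  `|∫⟪w(t), ψ(t)⟫ − ∫⟪w₀, ψ(0)⟫| ≤ K · √(∫_{(0,t]} ∫ |∇w|²) · √(∫_{(0,t]} ‖∇ψ‖²)`

— form perturbation times the geometric mean of the two dissipations (Lions–Magenes duality plus
Cauchy–Schwarz). [cite: LionsMagenes1972, Ch. 3 §4.3–4.4] [cite: Giaquinta1983MultipleIntegrals, Ch. III §2 eq. (2.1)-(2.3)] -/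
theorem ae_abs_integral_inner_sub_le (h : IsWeakTensorPassiveVectorDistortedOn A T 𝔸 b G w₀ w)
    (hψs : ∀ t, FunctionSpaces.Torus.IsSmooth (ψ t))
    (hψc : ∀ l : List d, Continuous (uncurry fun t y => FunctionSpaces.Torus.iterPartialDeriv l (ψ t) y))
    (hψL : ∃ L : ℝ, 0 ≤ L ∧ ∀ t ∈ Icc 0 T, ∀ s ∈ Icc 0 T, ∀ y, ‖ψ t y - ψ s y‖ ≤ L * |t - s|)
    (hψdiv : ∀ t, FunctionSpaces.Torus.IsDivFree (distort (G t) (ψ t)))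
    (hψ' : ∀ᵐ t ∂(volume.restrict (Ioo 0 T)), ∀ y, HasDerivAt (fun s => ψ s y) (ψ' t y) t)
    (hG : ∀ t i j, FunctionSpaces.Torus.IsSmooth (fun y => G t y i j))
    (hq : ∀ t, FunctionSpaces.Torus.IsSmooth (q t))
    (hadj : ∀ᵐ t ∂(volume.restrict (Ioo 0 T)), ∀ y,
      ψ' t y + FunctionSpaces.Torus.convect (b t) (ψ t) y + viscAdjVar (fun y => Visc4.conj (G t y) 𝔸₂) (ψ t) y +
          A • (WithLp.toLp 2 fun j => ⟪b t y, FunctionSpaces.Torus.partialDeriv j (ψ t) y⟫_ℝ) =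
        distort (fun y => (G t y).transpose) (FunctionSpaces.Torus.gradient (q t)) y)
    (hint : Integrable (fun p : ℝ × UnitAddTorus d =>
      ⟪w p.1 p.2, ψ' p.1 p.2 + FunctionSpaces.Torus.convect (b p.1) (ψ p.1) p.2 +
          viscAdjVar (fun y => Visc4.conj (G p.1 y) 𝔸) (ψ p.1) p.2⟫_ℝ +
        A * ⟪b p.1 p.2, FunctionSpaces.Torus.convect (w p.1) (ψ p.1) p.2⟫_ℝ)
      (((volume : Measure ℝ).restrict (Ioo 0 T)).prod volume))
    (hintV : Integrable (fun p : ℝ × UnitAddTorus d =>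
      ⟪w p.1 p.2, viscAdjVar (fun y => Visc4.conj (G p.1 y) (𝔸 - 𝔸₂)) (ψ p.1) p.2⟫_ℝ)
      (((volume : Measure ℝ).restrict (Ioo 0 T)).prod volume))
    (hintQ : Integrable (fun p : ℝ × UnitAddTorus d =>
      ⟪w p.1 p.2, distort (fun y => (G p.1 y).transpose) (FunctionSpaces.Torus.gradient (q p.1)) p.2⟫_ℝ)
      (((volume : Measure ℝ).restrict (Ioo 0 T)).prod volume))
    (hK0 : 0 ≤ K)
    (hK : ∀ t y (ξ η : d → d → ℝ), |∑ l, ∑ i, ∑ c, ∑ e, Visc4.conj (G t y) (𝔸 - 𝔸₂) i c l e * ξ c i * η e l| ≤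
      K * Real.sqrt (∑ c, ∑ i, ξ c i ^ 2) * Real.sqrt (∑ e, ∑ l, η e l ^ 2))
    (hGw : ∀ᵐ t ∂(volume.restrict (Ioo 0 T)),
      HasWeakGradient (w t) (Gw t) ∧ Integrable (Gw t) volume ∧ Integrable (weakGradNormSq (Gw t)) volume)
    (hDw : IntegrableOn (fun t => ∫ x, weakGradNormSq (Gw t) x) (Ioo 0 T) volume)
    (hDψ : IntegrableOn (fun t => FunctionSpaces.Torus.gradNormSq (ψ t)) (Ioo 0 T) volume) :
    ∀ᵐ t ∂(volume.restrict (Ioo 0 T)),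
      |(∫ x, ⟪w t x, ψ t x⟫_ℝ) - ∫ x, ⟪w₀ x, ψ 0 x⟫_ℝ| ≤
        K * Real.sqrt (∫ τ in Ioc 0 t, ∫ x, weakGradNormSq (Gw τ) x) *
          Real.sqrt (∫ τ in Ioc 0 t, FunctionSpaces.Torus.gradNormSq (ψ τ)) := by
  have hG1 : ∀ t i j, FunctionSpaces.Torus.IsContDiff 1 (fun y => G t y i j) := fun t i j =>
    (hG t i j).isContDiff (by simp)
  have h1 := h.ae_integral_inner_adjoint_eq hψs hψc hψL hψdiv hψ' hG1 hq hadj hint hintV hintQ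
  have hwi : ∀ᵐ t ∂(volume.restrict (Ioo 0 T)), Integrable (w t) volume :=
    h.ae_memLp_two.mono fun t ht => ht.integrable one_le_two
  filter_upwards [h1, ae_restrict_mem measurableSet_Ioo] with t ht htT
  rw [ht, add_sub_cancel_left]
  have hsub : Ioc 0 t ⊆ Ioo 0 T := fun τ hτ => ⟨hτ.1, lt_of_le_of_lt hτ.2 htT.2⟩
  exact abs_setIntegral_integral_inner_viscAdjVar_le measurableSet_Ioc
    (fun τ i c l e => isSmooth_conj_entry (hG τ) (𝔸 - 𝔸₂) i c l e) hK0 hK hψs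
    (ae_restrict_of_ae_restrict_of_subset hsub hwi)
    (ae_restrict_of_ae_restrict_of_subset hsub hGw) (hDw.mono_set hsub) (hDψ.mono_set hsub)

end IsWeakTensorPassiveVectorDistortedOn

end DualityEstimate

/-! ## §6 Discharging the integrability hypotheses from jointly continuous data -/

section Integrability

/-! ### Joint continuity of the variable-coefficient test operator and of conjugated tensors -/

section Coefficients

variable {𝔹 : ℝ → UnitAddTorus d → Visc4 d} {ψ : ℝ → UnitAddTorus d → EuclideanSpace ℝ d}
  {G : ℝ → UnitAddTorus d → Matrix d d ℝ}

/-- Joint continuity of a component of a first space derivative of a field all of whose iterated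
space derivatives are jointly continuous. [folklore] -/
private theorem continuous_uncurry_partialDeriv_apply
    (hψc : ∀ l : List d, Continuous (uncurry fun t y => FunctionSpaces.Torus.iterPartialDeriv l (ψ t) y))
    (c i : d) : Continuous (uncurry fun t y => (FunctionSpaces.Torus.partialDeriv c (ψ t) y) i) := by
  have h1 : Continuous (uncurry fun t y => FunctionSpaces.Torus.partialDeriv c (ψ t) y) := by
    simpa using hψc [c]
  exact (PiLp.continuous_apply 2 _ i).comp h1

/-- Joint continuity of a component of a second space derivative (same hypothesis). [folklore] -/
private theorem continuous_uncurry_partialDeriv₂_apply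
    (hψc : ∀ l : List d, Continuous (uncurry fun t y => FunctionSpaces.Torus.iterPartialDeriv l (ψ t) y))
    (e c i : d) :
    Continuous (uncurry fun t y =>
      (FunctionSpaces.Torus.partialDeriv e (FunctionSpaces.Torus.partialDeriv c (ψ t)) y) i) := by
  have h1 : Continuous (uncurry fun t y =>
      FunctionSpaces.Torus.partialDeriv e (FunctionSpaces.Torus.partialDeriv c (ψ t)) y) := by
    simpa using hψc [e, c]
  exact (PiLp.continuous_apply 2 _ i).comp h1

/-- **`(t, x) ↦ 𝓛^{𝔹(t),*} ψ(t)(x)` is jointly continuous** when the coefficients `𝔹(t,y)` are `C¹` in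
`y` slice-wise with `𝔹` and `∂_y 𝔹` jointly continuous, and `ψ` is space-smooth with all iterated
space derivatives jointly continuous (product rule inside `viscAdjVar`).
[cite: Giaquinta1983MultipleIntegrals, Ch. III §2 eq. (2.1)-(2.3)] -/
theorem continuous_uncurry_viscAdjVar
    (h𝔹1 : ∀ t i c l e, FunctionSpaces.Torus.IsContDiff 1 (fun y => 𝔹 t y i c l e))
    (h𝔹c : ∀ i c l e, Continuous (uncurry fun t y => 𝔹 t y i c l e))
    (h𝔹d : ∀ i c l e e', Continuous (uncurry fun t y =>
      FunctionSpaces.Torus.partialDeriv e' (fun y => 𝔹 t y i c l e) y))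
    (hψs : ∀ t, FunctionSpaces.Torus.IsSmooth (ψ t))
    (hψc : ∀ l : List d, Continuous (uncurry fun t y => FunctionSpaces.Torus.iterPartialDeriv l (ψ t) y)) :
    Continuous (uncurry fun t x => viscAdjVar (𝔹 t) (ψ t) x) := by
  have hΨ1 : ∀ t c, FunctionSpaces.Torus.IsContDiff 1 (FunctionSpaces.Torus.partialDeriv c (ψ t)) :=
    fun t c => ((hψs t).partialDeriv c).isContDiff (by simp)
  have hΨ1i : ∀ t c i, FunctionSpaces.Torus.IsContDiff 1 (fun y => (FunctionSpaces.Torus.partialDeriv c (ψ t) y) i) :=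
    fun t c i => (((hψs t).partialDeriv c).apply i).isContDiff (by simp)
  -- the expanded summand is jointly continuous
  have hterm : ∀ i c l e, Continuous (uncurry fun t x => FunctionSpaces.Torus.partialDeriv e
      (fun y => 𝔹 t y i c l e * (FunctionSpaces.Torus.partialDeriv c (ψ t) y) i) x) := by
    intro i c l e
    have e1 : (uncurry fun t x => FunctionSpaces.Torus.partialDeriv e
        (fun y => 𝔹 t y i c l e * (FunctionSpaces.Torus.partialDeriv c (ψ t) y) i) x) =
        fun p : ℝ × UnitAddTorus d => 𝔹 p.1 p.2 i c l e *
            (FunctionSpaces.Torus.partialDeriv e (FunctionSpaces.Torus.partialDeriv c (ψ p.1)) p.2) i +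
          FunctionSpaces.Torus.partialDeriv e (fun y => 𝔹 p.1 y i c l e) p.2 *
            (FunctionSpaces.Torus.partialDeriv c (ψ p.1) p.2) i := by
      funext p
      simp only [uncurry]
      rw [FunctionSpaces.Torus.partialDeriv_mul (h𝔹1 p.1 i c l e) (hΨ1i p.1 c i),
        FunctionSpaces.Torus.partialDeriv_apply_coord (hΨ1 p.1 c)]
    rw [e1]
    exact ((h𝔹c i c l e).mul (continuous_uncurry_partialDeriv₂_apply hψc e c i)).add
      ((h𝔹d i c l e e).mul (continuous_uncurry_partialDeriv_apply hψc c i))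
  have e2 : (uncurry fun t x => viscAdjVar (𝔹 t) (ψ t) x) = fun p : ℝ × UnitAddTorus d =>
      ∑ j, (∑ i, ∑ c, ∑ e, FunctionSpaces.Torus.partialDeriv e
        (fun y => 𝔹 p.1 y i c j e * (FunctionSpaces.Torus.partialDeriv c (ψ p.1) y) i) p.2) •
        EuclideanSpace.single j (1 : ℝ) := by
    funext p; rfl
  rw [e2]
  refine continuous_finsetSum _ fun j _ => ?_
  have hs : Continuous fun p : ℝ × UnitAddTorus d => ∑ i, ∑ c, ∑ e, FunctionSpaces.Torus.partialDeriv e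
      (fun y => 𝔹 p.1 y i c j e * (FunctionSpaces.Torus.partialDeriv c (ψ p.1) y) i) p.2 :=
    continuous_finsetSum _ fun i _ => continuous_finsetSum _ fun c _ =>
      continuous_finsetSum _ fun e _ => hterm i c j e
  exact hs.smul continuous_const

omit [DecidableEq d] in
/-- Entries of `𝔹^{G(y)}` are `C¹` in `y` when the entries of `G` are. [cite: Giaquinta1983MultipleIntegrals, Ch. III §2 eq. (2.1)-(2.3)] -/
theorem isContDiff_one_conj_entry {Gs : UnitAddTorus d → Matrix d d ℝ}
    (hG1 : ∀ i j, FunctionSpaces.Torus.IsContDiff 1 (fun y => Gs y i j)) (𝔹₀ : Visc4 d) (i c l e : d) :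
    FunctionSpaces.Torus.IsContDiff 1 (fun y => Visc4.conj (Gs y) 𝔹₀ i c l e) := by
  simp only [Visc4.conj_apply]
  unfold FunctionSpaces.Torus.IsContDiff at hG1 ⊢
  exact ContDiff.sum fun a _ => ContDiff.sum fun b' _ => ((hG1 c a).mul contDiff_const).mul (hG1 e b')

omit [DecidableEq d] in
/-- Entries of `𝔹^{G(t,y)}` are jointly continuous when the entries of `G` are.
[cite: Giaquinta1983MultipleIntegrals, Ch. III §2 eq. (2.1)-(2.3)] -/
theorem continuous_uncurry_conj_entry (hGc : ∀ i j, Continuous (uncurry fun t y => G t y i j))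
    (𝔹₀ : Visc4 d) (i c l e : d) :
    Continuous (uncurry fun t y => Visc4.conj (G t y) 𝔹₀ i c l e) := by
  have e1 : (uncurry fun t y => Visc4.conj (G t y) 𝔹₀ i c l e) =
      fun p : ℝ × UnitAddTorus d => ∑ a, ∑ b', G p.1 p.2 c a * 𝔹₀ i a l b' * G p.1 p.2 e b' := by
    funext p; simp only [uncurry, Visc4.conj_apply]
  rw [e1]
  exact continuous_finsetSum _ fun a _ => continuous_finsetSum _ fun b' _ =>
    ((hGc c a).mul continuous_const).mul (hGc e b')

omit [Fintype d] in
/-- Partial derivatives of constants vanish. [folklore] -/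
private theorem partialDeriv_const₅ (c : ℝ) (l : d) (x : UnitAddTorus d) :
    FunctionSpaces.Torus.partialDeriv l (fun _ : UnitAddTorus d => c) x = 0 := by
  simp [FunctionSpaces.Torus.partialDeriv, FunctionSpaces.Torus.lineDeriv]

/-- The `y`-derivatives of the entries of `𝔹^{G(t,y)}` are jointly continuous when `G` has `C¹`
slices with `G` and `∂_y G` jointly continuous (product rule).
[cite: Giaquinta1983MultipleIntegrals, Ch. III §2 eq. (2.1)-(2.3)] -/
theorem continuous_uncurry_partialDeriv_conj_entry
    (hG1 : ∀ t i j, FunctionSpaces.Torus.IsContDiff 1 (fun y => G t y i j))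
    (hGc : ∀ i j, Continuous (uncurry fun t y => G t y i j))
    (hGd : ∀ i j e', Continuous (uncurry fun t y => FunctionSpaces.Torus.partialDeriv e' (fun y => G t y i j) y))
    (𝔹₀ : Visc4 d) (i c l e e' : d) :
    Continuous (uncurry fun t y =>
      FunctionSpaces.Torus.partialDeriv e' (fun y => Visc4.conj (G t y) 𝔹₀ i c l e) y) := by
  have hprod : ∀ t a b', FunctionSpaces.Torus.IsContDiff 1 (fun y => G t y c a * 𝔹₀ i a l b' * G t y e b') :=
    fun t a b' => by
      unfold FunctionSpaces.Torus.IsContDiff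
      exact ((hG1 t c a).mul contDiff_const).mul (hG1 t e b')
  have hca : ∀ t a b', FunctionSpaces.Torus.IsContDiff 1 (fun y => G t y c a * 𝔹₀ i a l b') := fun t a b' => by
    unfold FunctionSpaces.Torus.IsContDiff
    exact (hG1 t c a).mul contDiff_const
  have e1 : (uncurry fun t y => FunctionSpaces.Torus.partialDeriv e' (fun y => Visc4.conj (G t y) 𝔹₀ i c l e) y) =
      fun p : ℝ × UnitAddTorus d => ∑ a, ∑ b',
        ((G p.1 p.2 c a * 𝔹₀ i a l b') * FunctionSpaces.Torus.partialDeriv e' (fun y => G p.1 y e b') p.2 +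
          (FunctionSpaces.Torus.partialDeriv e' (fun y => G p.1 y c a) p.2 * 𝔹₀ i a l b') * G p.1 p.2 e b') := by
    funext p
    simp only [uncurry]
    rw [show (fun y => Visc4.conj (G p.1 y) 𝔹₀ i c l e) =
        fun y => ∑ a, ∑ b', G p.1 y c a * 𝔹₀ i a l b' * G p.1 y e b' from funext fun y => Visc4.conj_apply _ _ _ _ _ _]
    rw [FunctionSpaces.Torus.partialDeriv_finset_sum _ (fun a _ => ?_)]
    · refine Finset.sum_congr rfl fun a _ => ?_
      rw [FunctionSpaces.Torus.partialDeriv_finset_sum _ (fun b' _ => hprod p.1 a b')]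
      refine Finset.sum_congr rfl fun b' _ => ?_
      rw [FunctionSpaces.Torus.partialDeriv_mul (hca p.1 a b') (hG1 p.1 e b'),
        FunctionSpaces.Torus.partialDeriv_mul (hG1 p.1 c a) (FunctionSpaces.Torus.isContDiff_const _),
        partialDeriv_const₅, mul_zero, zero_add]
    · unfold FunctionSpaces.Torus.IsContDiff
      exact ContDiff.sum fun b' _ => hprod p.1 a b'
  rw [e1]
  refine continuous_finsetSum _ fun a _ => continuous_finsetSum _ fun b' _ => ?_
  exact ((((hGc c a).mul continuous_const)).mul (hGd e b' e')).add
    ((((hGd c a e').mul continuous_const)).mul (hGc e b'))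

omit [DecidableEq d] in
/-- `(t, y) ↦ G(t,y)ᵀ z(t,y)` is jointly continuous for jointly continuous `G` and `z` (e.g. `z = ∇q`).
[cite: Temam1997, Ch. II §3.1–3.2, (3.2)–(3.5), Thm. 3.1] -/
theorem continuous_uncurry_distort_transpose {z : ℝ → UnitAddTorus d → EuclideanSpace ℝ d}
    (hGc : ∀ i j, Continuous (uncurry fun t y => G t y i j)) (hz : Continuous (uncurry z)) :
    Continuous (uncurry fun t y => distort (fun y => (G t y).transpose) (z t) y) := by
  have hM : Continuous fun p : ℝ × UnitAddTorus d => (G p.1 p.2).transpose :=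
    continuous_pi fun i => continuous_pi fun j => by
      show Continuous fun p : ℝ × UnitAddTorus d => G p.1 p.2 j i
      exact hGc j i
  have hv : Continuous fun p : ℝ × UnitAddTorus d => WithLp.ofLp (z p.1 p.2) :=
    (PiLp.continuous_ofLp 2 _).comp hz
  exact (PiLp.continuous_toLp 2 _).comp (hM.matrix_mulVec hv)

end Coefficients

/-! ### Product integrability for the distorted class -/

namespace IsWeakTensorPassiveVectorDistortedOn

variable {A T : ℝ} {𝔸 : Visc4 d} {b w : ℝ → UnitAddTorus d → EuclideanSpace ℝ d}
  {G : ℝ → UnitAddTorus d → Matrix d d ℝ} {w₀ : UnitAddTorus d → EuclideanSpace ℝ d}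
  {Φ ψ : ℝ → UnitAddTorus d → EuclideanSpace ℝ d} {q : ℝ → UnitAddTorus d → ℝ}

/-- `‖b‖ ‖w‖ ∈ L¹((0,T) × T^d)` (distorted class). [cite: DiPernaLions1989, §II.1 (12)–(14)] -/
theorem integrable_norm_carrier_mul_norm (h : IsWeakTensorPassiveVectorDistortedOn A T 𝔸 b G w₀ w) :
    Integrable (fun p : ℝ × UnitAddTorus d => ‖b p.1 p.2‖ * ‖w p.1 p.2‖)
      (((volume : Measure ℝ).restrict (Ioo 0 T)).prod volume) := by
  have hm : AEStronglyMeasurable (fun p : ℝ × UnitAddTorus d => ‖b p.1 p.2‖ * ‖w p.1 p.2‖)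
      (((volume : Measure ℝ).restrict (Ioo 0 T)).prod volume) :=
    h.aestronglyMeasurable_uncurry_carrier.norm.mul h.aestronglyMeasurable_uncurry.norm
  refine ⟨hm, ?_⟩
  rw [hasFiniteIntegral_iff_enorm, lintegral_prod _ hm.enorm]
  have h' := h.lintegral_mul_lt_top
  simp only [enorm_mul, enorm_norm] at h' ⊢
  exact h'

/-- Integrability on `(0,T) × T^d` of `⟪w, Φ⟫` for a jointly measurable field `Φ` bounded on
`(0,T) × T^d`. [cite: DiPernaLions1989, §II.1 (12)–(14)] -/
theorem integrable_inner_of_bounded (h : IsWeakTensorPassiveVectorDistortedOn A T 𝔸 b G w₀ w)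
    (hΦm : AEStronglyMeasurable (uncurry Φ) (((volume : Measure ℝ).restrict (Ioo 0 T)).prod volume))
    {M : ℝ} (hΦM : ∀ t ∈ Ioo 0 T, ∀ x, ‖Φ t x‖ ≤ M) :
    Integrable (fun p : ℝ × UnitAddTorus d => ⟪w p.1 p.2, Φ p.1 p.2⟫_ℝ)
      (((volume : Measure ℝ).restrict (Ioo 0 T)).prod volume) := by
  refine Integrable.mono' (g := fun p : ℝ × UnitAddTorus d => ‖uncurry w p‖ * M)
    (h.integrable_uncurry.norm.mul_const M) (h.aestronglyMeasurable_uncurry.inner hΦm) ?_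
  filter_upwards [ae_fst_mem_Ioo₅ (d := d) T] with p hp
  exact (norm_inner_le_norm _ _).trans (mul_le_mul_of_nonneg_left (hΦM p.1 hp p.2) (norm_nonneg _))

/-- Integrability on `(0,T) × T^d` of `bⱼ ⟪w, Φ⟫` for a jointly continuous field `Φ` (distorted class).
[cite: DiPernaLions1989, §II.1 (12)–(14)] -/
theorem integrable_carrier_mul_inner_of_continuous (h : IsWeakTensorPassiveVectorDistortedOn A T 𝔸 b G w₀ w)
    (hΦ : Continuous (uncurry Φ)) (j : d) :
    Integrable (fun p : ℝ × UnitAddTorus d => b p.1 p.2 j * ⟪w p.1 p.2, Φ p.1 p.2⟫_ℝ)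
      (((volume : Measure ℝ).restrict (Ioo 0 T)).prod volume) := by
  obtain ⟨C₀, hC₀⟩ := exists_bound_of_continuous_uncurry hΦ 0 T
  have hm : AEStronglyMeasurable (fun p : ℝ × UnitAddTorus d => b p.1 p.2 j * ⟪w p.1 p.2, Φ p.1 p.2⟫_ℝ)
      (((volume : Measure ℝ).restrict (Ioo 0 T)).prod volume) :=
    ((EuclideanSpace.proj j).continuous.comp_aestronglyMeasurable h.aestronglyMeasurable_uncurry_carrier).mul
      (h.aestronglyMeasurable_uncurry.inner hΦ.aestronglyMeasurable)
  refine Integrable.mono' (g := fun p : ℝ × UnitAddTorus d => ‖b p.1 p.2‖ * ‖w p.1 p.2‖ * C₀)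
    (h.integrable_norm_carrier_mul_norm.mul_const C₀) hm ?_
  filter_upwards [ae_fst_mem_Ioo₅ (d := d) T] with p hp
  rw [norm_mul]
  calc ‖b p.1 p.2 j‖ * ‖⟪w p.1 p.2, Φ p.1 p.2⟫_ℝ‖ ≤ ‖b p.1 p.2‖ * (‖w p.1 p.2‖ * C₀) :=
        mul_le_mul (by simpa [Real.norm_eq_abs] using FunctionSpaces.Torus.abs_apply_le_norm (b p.1 p.2) j)
          ((norm_inner_le_norm _ _).trans (mul_le_mul_of_nonneg_left (hC₀ p.1 (Ioo_subset_Icc_self hp) p.2)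
            (norm_nonneg _))) (norm_nonneg _) (norm_nonneg _)
    _ = ‖b p.1 p.2‖ * ‖w p.1 p.2‖ * C₀ := by ring

/-- Integrability on `(0,T) × T^d` of `wⱼ ⟪b, Φ⟫` for a jointly continuous field `Φ` (distorted class).
[cite: DiPernaLions1989, §II.1 (12)–(14)] -/
theorem integrable_mul_inner_carrier_of_continuous (h : IsWeakTensorPassiveVectorDistortedOn A T 𝔸 b G w₀ w)
    (hΦ : Continuous (uncurry Φ)) (j : d) :
    Integrable (fun p : ℝ × UnitAddTorus d => w p.1 p.2 j * ⟪b p.1 p.2, Φ p.1 p.2⟫_ℝ)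
      (((volume : Measure ℝ).restrict (Ioo 0 T)).prod volume) := by
  obtain ⟨C₀, hC₀⟩ := exists_bound_of_continuous_uncurry hΦ 0 T
  have hm : AEStronglyMeasurable (fun p : ℝ × UnitAddTorus d => w p.1 p.2 j * ⟪b p.1 p.2, Φ p.1 p.2⟫_ℝ)
      (((volume : Measure ℝ).restrict (Ioo 0 T)).prod volume) :=
    ((EuclideanSpace.proj j).continuous.comp_aestronglyMeasurable h.aestronglyMeasurable_uncurry).mul
      (h.aestronglyMeasurable_uncurry_carrier.inner hΦ.aestronglyMeasurable)
  refine Integrable.mono' (g := fun p : ℝ × UnitAddTorus d => ‖b p.1 p.2‖ * ‖w p.1 p.2‖ * C₀)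
    (h.integrable_norm_carrier_mul_norm.mul_const C₀) hm ?_
  filter_upwards [ae_fst_mem_Ioo₅ (d := d) T] with p hp
  rw [norm_mul]
  calc ‖w p.1 p.2 j‖ * ‖⟪b p.1 p.2, Φ p.1 p.2⟫_ℝ‖ ≤ ‖w p.1 p.2‖ * (‖b p.1 p.2‖ * C₀) :=
        mul_le_mul (by simpa [Real.norm_eq_abs] using FunctionSpaces.Torus.abs_apply_le_norm (w p.1 p.2) j)
          ((norm_inner_le_norm _ _).trans (mul_le_mul_of_nonneg_left (hC₀ p.1 (Ioo_subset_Icc_self hp) p.2)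
            (norm_nonneg _))) (norm_nonneg _) (norm_nonneg _)
    _ = ‖b p.1 p.2‖ * ‖w p.1 p.2‖ * C₀ := by ring

/-- Integrability on `(0,T) × T^d` of the transport pairing `⟪w, (b(t)·∇)Φ(t)⟫` for a field `Φ` that
is `C¹` in space with jointly continuous first derivatives (distorted class). [cite: DiPernaLions1989, §II.1 (12)–(14)] -/
theorem integrable_inner_convect (h : IsWeakTensorPassiveVectorDistortedOn A T 𝔸 b G w₀ w)
    (hΦ1 : ∀ t, FunctionSpaces.Torus.IsContDiff 1 (Φ t))
    (hΦd : ∀ j, Continuous (uncurry fun t x => FunctionSpaces.Torus.partialDeriv j (Φ t) x)) :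
    Integrable (fun p : ℝ × UnitAddTorus d => ⟪w p.1 p.2, FunctionSpaces.Torus.convect (b p.1) (Φ p.1) p.2⟫_ℝ)
      (((volume : Measure ℝ).restrict (Ioo 0 T)).prod volume) := by
  have e : (fun p : ℝ × UnitAddTorus d => ⟪w p.1 p.2, FunctionSpaces.Torus.convect (b p.1) (Φ p.1) p.2⟫_ℝ) =
      fun p => ∑ j, b p.1 p.2 j * ⟪w p.1 p.2, FunctionSpaces.Torus.partialDeriv j (Φ p.1) p.2⟫_ℝ := by
    funext p
    exact IsWeakPassiveVectorOn.inner_convect_eq_sum' (hΦ1 p.1) _ _ _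
  rw [e]
  exact integrable_finsetSum _ fun j _ => h.integrable_carrier_mul_inner_of_continuous (hΦd j) j

/-- Integrability on `(0,T) × T^d` of the stretching pairing `⟪b, (w(t)·∇)Φ(t)⟫` (same hypotheses,
distorted class). [cite: DiPernaLions1989, §II.1 (12)–(14)] -/
theorem integrable_inner_carrier_convect (h : IsWeakTensorPassiveVectorDistortedOn A T 𝔸 b G w₀ w)
    (hΦ1 : ∀ t, FunctionSpaces.Torus.IsContDiff 1 (Φ t))
    (hΦd : ∀ j, Continuous (uncurry fun t x => FunctionSpaces.Torus.partialDeriv j (Φ t) x)) :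
    Integrable (fun p : ℝ × UnitAddTorus d => ⟪b p.1 p.2, FunctionSpaces.Torus.convect (w p.1) (Φ p.1) p.2⟫_ℝ)
      (((volume : Measure ℝ).restrict (Ioo 0 T)).prod volume) := by
  have e : (fun p : ℝ × UnitAddTorus d => ⟪b p.1 p.2, FunctionSpaces.Torus.convect (w p.1) (Φ p.1) p.2⟫_ℝ) =
      fun p => ∑ j, w p.1 p.2 j * ⟪b p.1 p.2, FunctionSpaces.Torus.partialDeriv j (Φ p.1) p.2⟫_ℝ := by
    funext p
    exact IsWeakPassiveVectorOn.inner_convect_eq_sum' (hΦ1 p.1) _ _ _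
  rw [e]
  exact integrable_finsetSum _ fun j _ => h.integrable_mul_inner_carrier_of_continuous (hΦd j) j

/-- Integrability on `(0,T) × T^d` of `⟪w, ∂ₜψ⟫` (`∂ₜψ = timeDeriv ψ`, the pointwise `deriv`) for a
jointly continuous field `ψ` that is Lipschitz in `t` on `[0,T]` uniformly in `y`: the time derivative
is jointly measurable (`measurable_deriv_with_param`) and bounded by the Lipschitz constant on `(0,T)`.
[cite: DiPernaLions1989, §II.1 (12)–(14)] -/
theorem integrable_inner_timeDeriv (h : IsWeakTensorPassiveVectorDistortedOn A T 𝔸 b G w₀ w)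
    (hψ0 : Continuous (uncurry ψ))
    (hψL : ∃ L : ℝ, 0 ≤ L ∧ ∀ t ∈ Icc 0 T, ∀ s ∈ Icc 0 T, ∀ y, ‖ψ t y - ψ s y‖ ≤ L * |t - s|) :
    Integrable (fun p : ℝ × UnitAddTorus d => ⟪w p.1 p.2, FunctionSpaces.Torus.timeDeriv ψ p.1 p.2⟫_ℝ)
      (((volume : Measure ℝ).restrict (Ioo 0 T)).prod volume) := by
  obtain ⟨L, hL0, hL⟩ := hψL
  -- joint measurability of the time derivative, through the parameter `y`
  have hsw : Continuous (uncurry fun (y : UnitAddTorus d) (t : ℝ) => ψ t y) :=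
    hψ0.comp continuous_swap
  have hmeas : Measurable fun p : UnitAddTorus d × ℝ => deriv (fun t => ψ t p.1) p.2 :=
    measurable_deriv_with_param hsw
  have hm : AEStronglyMeasurable (uncurry (FunctionSpaces.Torus.timeDeriv ψ))
      (((volume : Measure ℝ).restrict (Ioo 0 T)).prod volume) := by
    have e : uncurry (FunctionSpaces.Torus.timeDeriv ψ) =
        (fun p : UnitAddTorus d × ℝ => deriv (fun t => ψ t p.1) p.2) ∘ Prod.swap := by
      funext p; rfl
    rw [e]
    exact ((hmeas.comp measurable_swap).stronglyMeasurable).aestronglyMeasurable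
  refine h.integrable_inner_of_bounded hm (M := L) fun t ht x => ?_
  exact norm_deriv_le_of_lipschitzOn hL0 (fun t ht s hs => hL t ht s hs x) ht

/-- **Discharge of `hint` (ψ' = ∂ₜψ)**: the space–time weak integrand
`⟪w, ∂ₜψ + (b·∇)ψ + 𝓛^{G,*}_{𝔹₀} ψ⟫ + A⟪b, (w·∇)ψ⟫` is integrable on `(0,T) × T^d` for a time-Lipschitz
space-smooth field `ψ` (all iterated space derivatives jointly continuous) when `G` has `C¹` slices with
`G`, `∂_y G` jointly continuous. [cite: DiPernaLions1989, §II.1 (12)–(14)] -/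
theorem integrable_weakIntegrand_lipschitzField (h : IsWeakTensorPassiveVectorDistortedOn A T 𝔸 b G w₀ w)
    (hψs : ∀ t, FunctionSpaces.Torus.IsSmooth (ψ t))
    (hψc : ∀ l : List d, Continuous (uncurry fun t y => FunctionSpaces.Torus.iterPartialDeriv l (ψ t) y))
    (hψL : ∃ L : ℝ, 0 ≤ L ∧ ∀ t ∈ Icc 0 T, ∀ s ∈ Icc 0 T, ∀ y, ‖ψ t y - ψ s y‖ ≤ L * |t - s|)
    (hG1 : ∀ t i j, FunctionSpaces.Torus.IsContDiff 1 (fun y => G t y i j))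
    (hGc : ∀ i j, Continuous (uncurry fun t y => G t y i j))
    (hGd : ∀ i j e', Continuous (uncurry fun t y => FunctionSpaces.Torus.partialDeriv e' (fun y => G t y i j) y))
    (𝔹₀ : Visc4 d) :
    Integrable (fun p : ℝ × UnitAddTorus d =>
      ⟪w p.1 p.2, FunctionSpaces.Torus.timeDeriv ψ p.1 p.2 + FunctionSpaces.Torus.convect (b p.1) (ψ p.1) p.2 +
          viscAdjVar (fun y => Visc4.conj (G p.1 y) 𝔹₀) (ψ p.1) p.2⟫_ℝ +
        A * ⟪b p.1 p.2, FunctionSpaces.Torus.convect (w p.1) (ψ p.1) p.2⟫_ℝ)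
      (((volume : Measure ℝ).restrict (Ioo 0 T)).prod volume) := by
  have hψ1 : ∀ t, FunctionSpaces.Torus.IsContDiff 1 (ψ t) := fun t => (hψs t).isContDiff (by simp)
  have hψd : ∀ j, Continuous (uncurry fun t x => FunctionSpaces.Torus.partialDeriv j (ψ t) x) :=
    fun j => by simpa using hψc [j]
  have hV : Continuous (uncurry fun t x => viscAdjVar (fun y => Visc4.conj (G t y) 𝔹₀) (ψ t) x) :=
    continuous_uncurry_viscAdjVar (𝔹 := fun t y => Visc4.conj (G t y) 𝔹₀)
      (fun t i c l e => isContDiff_one_conj_entry (hG1 t) 𝔹₀ i c l e)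
      (fun i c l e => continuous_uncurry_conj_entry hGc 𝔹₀ i c l e)
      (fun i c l e e' => continuous_uncurry_partialDeriv_conj_entry hG1 hGc hGd 𝔹₀ i c l e e') hψs hψc
  have e : (fun p : ℝ × UnitAddTorus d =>
      ⟪w p.1 p.2, FunctionSpaces.Torus.timeDeriv ψ p.1 p.2 + FunctionSpaces.Torus.convect (b p.1) (ψ p.1) p.2 +
          viscAdjVar (fun y => Visc4.conj (G p.1 y) 𝔹₀) (ψ p.1) p.2⟫_ℝ +
        A * ⟪b p.1 p.2, FunctionSpaces.Torus.convect (w p.1) (ψ p.1) p.2⟫_ℝ) =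
      fun p => (⟪w p.1 p.2, FunctionSpaces.Torus.timeDeriv ψ p.1 p.2⟫_ℝ +
        ⟪w p.1 p.2, FunctionSpaces.Torus.convect (b p.1) (ψ p.1) p.2⟫_ℝ +
        ⟪w p.1 p.2, (fun t x => viscAdjVar (fun y => Visc4.conj (G t y) 𝔹₀) (ψ t) x) p.1 p.2⟫_ℝ) +
        A * ⟪b p.1 p.2, FunctionSpaces.Torus.convect (w p.1) (ψ p.1) p.2⟫_ℝ := by
    funext p
    rw [inner_add_right, inner_add_right]
  rw [e]
  refine (((h.integrable_inner_timeDeriv (by simpa using hψc []) hψL).add (h.integrable_inner_convect hψ1 hψd)).add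
    (h.integrable_inner_of_continuous hV)).add ((h.integrable_inner_carrier_convect hψ1 hψd).const_mul A)

/-- **Discharge of `hintV`**: `⟪w, 𝓛^{G,*}_{𝔹₀} ψ⟫` is integrable on `(0,T) × T^d` (any constant tensor
`𝔹₀`, e.g. `𝔸 − 𝔸₂`) under the same hypotheses. [cite: Giaquinta1983MultipleIntegrals, Ch. III §2 eq. (2.1)-(2.3)] -/
theorem integrable_inner_viscAdjVar_conj (h : IsWeakTensorPassiveVectorDistortedOn A T 𝔸 b G w₀ w)
    (hψs : ∀ t, FunctionSpaces.Torus.IsSmooth (ψ t))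
    (hψc : ∀ l : List d, Continuous (uncurry fun t y => FunctionSpaces.Torus.iterPartialDeriv l (ψ t) y))
    (hG1 : ∀ t i j, FunctionSpaces.Torus.IsContDiff 1 (fun y => G t y i j))
    (hGc : ∀ i j, Continuous (uncurry fun t y => G t y i j))
    (hGd : ∀ i j e', Continuous (uncurry fun t y => FunctionSpaces.Torus.partialDeriv e' (fun y => G t y i j) y))
    (𝔹₀ : Visc4 d) :
    Integrable (fun p : ℝ × UnitAddTorus d =>
      ⟪w p.1 p.2, viscAdjVar (fun y => Visc4.conj (G p.1 y) 𝔹₀) (ψ p.1) p.2⟫_ℝ)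
      (((volume : Measure ℝ).restrict (Ioo 0 T)).prod volume) :=
  h.integrable_inner_of_continuous (Φ := fun t x => viscAdjVar (fun y => Visc4.conj (G t y) 𝔹₀) (ψ t) x)
    (continuous_uncurry_viscAdjVar (𝔹 := fun t y => Visc4.conj (G t y) 𝔹₀)
      (fun t i c l e => isContDiff_one_conj_entry (hG1 t) 𝔹₀ i c l e)
      (fun i c l e => continuous_uncurry_conj_entry hGc 𝔹₀ i c l e)
      (fun i c l e e' => continuous_uncurry_partialDeriv_conj_entry hG1 hGc hGd 𝔹₀ i c l e e') hψs hψc)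

/-- **Discharge of `hintQ`**: `⟪w, Gᵀ∇q⟫` is integrable on `(0,T) × T^d` for jointly continuous `G` and
`∇q`. [cite: Temam1997, Ch. II §3.1–3.2, (3.2)–(3.5), Thm. 3.1] -/
theorem integrable_inner_distort_transpose_gradient (h : IsWeakTensorPassiveVectorDistortedOn A T 𝔸 b G w₀ w)
    (hGc : ∀ i j, Continuous (uncurry fun t y => G t y i j))
    (hqc : Continuous (uncurry fun t y => FunctionSpaces.Torus.gradient (q t) y)) :
    Integrable (fun p : ℝ × UnitAddTorus d =>
      ⟪w p.1 p.2, distort (fun y => (G p.1 y).transpose) (FunctionSpaces.Torus.gradient (q p.1)) p.2⟫_ℝ)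
      (((volume : Measure ℝ).restrict (Ioo 0 T)).prod volume) :=
  h.integrable_inner_of_continuous
    (Φ := fun t y => distort (fun y => (G t y).transpose) (FunctionSpaces.Torus.gradient (q t)) y)
    (continuous_uncurry_distort_transpose hGc hqc)

end IsWeakTensorPassiveVectorDistortedOn

end Integrability

end Torus

end Literature.Analysis.FluidPDE

end
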